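import Literature.AlgebraicGeometry.AbelianVarieties.ThetaPowersFourierSL2
import Mathlib.Data.Nat.Choose.Dvd
import Mathlib.Data.Nat.Choose.Lucas
import Mathlib.Data.Nat.Prime.Int
import Mathlib.Data.Nat.Multiplicity
import Mathlib.Algebra.IsPrimePow
import Mathlib.RingTheory.PrincipalIdealDomain
import HarnessLib

/-!
# The theta-power lattice, companion file: integer shadows of the Gaussian slope, the `ζ₆`-plane, the seed
# kernel law and the end-coordinate law (every `g`, every commutative ring), the integral `Ψ^H`-fixed lattices at
# `g = 3, …, 7, 9`, the Tate `Ĥ⁻¹` sandwich (every `g`; instances at `g = 4, 7`), and the Eisenstein congruence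
# `π⁶ ≡ N(π)³ (mod 9λ)`, and the non-principal cube law `(T_n D_{n²} S)³ = (-1)^g n^{3g}` ([Mukai1981] (3.12) for `N = nΘ`)

Layer `Literature/AlgebraicGeometry/AbelianVarieties`, family `hodge`; companion of `ThetaPowersFourierSL2.lean` (which
is at the gate's 200 000-byte file cap). Same model, same conventions (basis `θ^k/k!`, `S` with Beauville's sign,
`T = ·e^θ`, `χ` = Mukai's pairing), same HONEST FRAMING: matrix algebra of the `(g+1)`-dimensional theta-power model
of a principally polarized abelian variety; the printed theorems ([Mukai1981] Thm. 3.13 / (3.14), [Beauville1983FourierChow]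
Prop. 5, [Mukai1987FourierFunctor] (1.19)–(1.20), [Fulton1998] Ex. 3.2.3) are CITED as the dictionary, not proved;
no abelian variety, sheaf or Chern character is constructed; nothing here says HC, HC_CM or HC_AV holds or that any
object is semiregular. No named fact, no `sorry`.

## What is proved (all `g`, any `CommRing R` unless stated)

* `gaussRe = (1,0,-1,0,…)`, `gaussIm = (0,1,0,-1,…)` (the integer shadows of the Gaussian slope `e^{iθ}` of the leaf's
  `fourier_mulVec_thetaExp_I`): `two_smul_gaussRe_and_gaussIm` (`2·gaussRe = e^{iθ} + e^{-iθ}`,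
  `2·gaussIm = (-i)(e^{iθ} - e^{-iθ})` over a ring with `i² = -1`) and **`fourier_mulVec_gaussRe_gaussIm`** : for EVERY
  `g` and every ring `S` preserves the plane `⟨gaussRe, gaussIm⟩` and acts on it as multiplication by
  `i^g = Re i^g + i Im i^g` (identity for `4 ∣ g`, `-1` for `g ≡ 2 (mod 4)`, rotation by `± i` for `g` odd);
  `gaussRe_gaussIm_four_six` writes `g = 4, 6` out.
* **`twist_mulVec_omegaRe_omegaIm`** : `T c = c^∨ = (2,1,-1,-2,-1,1,2,…)` and `T s = -s^∨ = (0,1,1,0,-1,-1,0,…)` for EVERY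
  `g` over every ring (`c = omegaRe`, `s = omegaIm` of the leaf; pulled back from `ℤ[ζ₃] = ℤ[X]/(X²+X+1)`): `⊗L` carries
  the `ζ₃`-plane `⟨c, s⟩` of `S T` to the `ζ₆`-plane; `twist_mul_fourier_mulVec_dualVec_omegaRe_omegaIm` : for `3 ∣ g`
  the `ζ₆`-plane `⟨c^∨, s^∨⟩` is the `(-1)^g`-eigenplane of `T S`; `dualVec_omegaRe_omegaIm_six` writes `g = 6` out
  (`(2,1,-1,-2,-1,1,2)`, `(0,1,1,0,-1,-1,0)` = the vectors `∝ Re φ(ζ₆)`, `∝ Im φ(ζ₆)` of HOME `widen/W5`).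
* Section `IntegralFixedLattices` (over `ℤ`; `Ψ = S T`, `ε = (-1)^g`, `N_g v = v + ε Ψ v + Ψ² v` = `normSum`, an
  `ε`-eigenclass for every `g` by `fourier_mul_twist_mulVec_normSum` / `normSum_mem_eigenClasses`; EVERY `g`:
  `normSum_eq_three_smul_of_mulVec_eq` (a `Ψ`-fixed class `f`, `Ψ f = ε f`, has norm `N_g f = 3 f`, so `3·Fix_g ⊆ N_g(L) ⊆ Fix_g`
  and `Fix_g / N_g(L)` is an `𝔽₃`-space), `normSum_apply_zero` (`(N_g f)_0 = f_0 + ε Σ_k C(g,k) f_k + f_g`, via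
  `fourier_mul_twist_mulVec_apply_zero` and `fourier_mul_twist_mulVec_mulVec_apply_zero` : `(Ψ² f)_0 = f_g` from the leaf's
  braid relation `T S T = cotwist`), and for EVERY PRIME `p ≠ 2, 3`: **`natCast_dvd_apply_zero_of_mulVec_eq`** — an integral
  class `f ∈ ℤ^{p+1}` with `S T f = -f` has `f_0 ∈ pℤ` (`3 f_0 = (N_p f)_0 ≡ 0 mod p` since `p ∣ C(p,k)`, `0 < k < p`); coordinates
  `fourier_mul_twist_mulVec_apply` : `(Ψ f)_m = (-1)^m Σ_k C(g-m, k) f_k`, written out as `fourier_mul_twist_mulVec_three`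
  / `_four` / `_six`, `normSum_three` / `_four` / `_six`): the INTEGRAL lattices `Fix^ℤ_g = ker_ℤ(Ψ - ε)` and
  `N_g(ℤ^{g+1})` — **`fourier_mul_twist_mulVec_eq_self_iff_six`** : `Fix^ℤ₆ = ℤ(1,0,1,-2,2,-1,1) ⊕ ℤ(0,1,1,-3,3,-1,0) ⊕
  ℤ(0,0,2,-3,2,0,0)` (`…_six'` : `= ℤ n₁ ⊕ ℤ n₂ ⊕ ℤ(0,0,2,-3,2,0,0)`); `exists_normSum_eq_iff_six` : `N₆(ℤ^7) = ℤ n₁ ⊕ ℤ n₂ ⊕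
  ℤ(0,0,6,-9,6,0,0)`, `n₁ = (1,0,3,-5,4,-1,1)`, `n₂ = (0,1,5,-9,7,-1,0)` (elementary divisors `(1,1,3)`: `Fix^ℤ₆/N₆(ℤ^7) ≅ ℤ/3`);
  `exists_normSum_eq_or_six` + `not_exists_normSum_eq_six` + `exists_normSum_eq_three_smul_six` : the quotient is generated
  by `v₂ = (2,-1,-1,2,-1,-1,2)`, which is not a norm (nor is `w = (20,-10,8,-7,8,-10,20)`), `3 f` is a norm for every fixed
  `f`, and `t = (0,1,-1,0,1,-1,0) = N₆(3e₀ - e₁)`, `3v₂ = N₆(3,-5,2,0,0,0,0)`, `N₆(e₀) = (2,-1,1,-1,1,-1,2)` (`normSum_six_examples`);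
  `euler_six_intBasis` : `χ`-Gram `[[-18,-39,-30],[-39,-78,-60],[-30,-60,-60]]` of `Fix^ℤ₆`;
  `fourier_mul_twist_mulVec_eq_self_iff_four` : `Fix^ℤ₄ = N₄(ℤ^5) = ℤ(2,-1,1,-1,2)` (index `1`; `normSum_four` :
  `N₄ f = (λ·f) N₄(e₀)`, `λ = (1,2,3,2,1)`; and the TWIN statement `normSum_eq_zero_not_coboundary_four` : `u = (-1,-1,0,1,1)`
  has `N₄ u = 0` but is NOT `S T v - v` for any `v ∈ ℤ^5` — a mod-`3` obstruction — while `3u = S T v - v` for `v = (0,0,2,-3,-3)`);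
  `fourier_mul_twist_mulVec_eq_neg_iff_three` : `Fix^ℤ₃ = ℤ(1,0,-1,1) ⊕ ℤ(0,1,-1,0)`
  (ANTI-fixed, `ε = -1`) and `N₃(ℤ^4) = ℤ(3,0,-3,3) ⊕ ℤ(0,1,-1,0)` (index `3`), `normSum_three_examples` (`v₂ = (2,-1,-1,2)` not
  a norm; `t₀ = N₃(e₀)`, `3v₂ = N₃(-1,-1,-1,-1)`), `euler_three_intBasis` (`χ((1,0,-1,1),(0,1,-1,0)) = -3`); and the two
  odd cases with NO quotient: `fourier_mul_twist_mulVec_eq_neg_iff_five` : `Fix^ℤ₅ = N₅(ℤ^6) = ℤ(5,0,-2,3,-5,5) ⊕ ℤ(0,1,-1,1,-1,0)`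
  and `fourier_mul_twist_mulVec_eq_neg_iff_seven` : `Fix^ℤ₇ = N₇(ℤ^8) = ℤ(7,0,-2,3,-4,5,-7,7) ⊕ ℤ(0,1,-1,1,-1,1,-1,0)` (index
  `1`; every integral anti-fixed class at `g = 5`, `7` is a norm and has `f₀ ∈ 5ℤ`, resp. `7ℤ`; `normSum_five` / `_seven`,
  `fourier_mul_twist_mulVec_five` / `_seven`) — the first instances of the pattern «`Fix^ℤ_g / N_g(ℤ^{g+1}) ≅ ℤ/3` iff `3 ∣ g`»
  observed by machine for `g ≤ 60` in HOME `widen/LIT-W/tools/mukai-g19/` (NOT a theorem of this file). The rational spans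
  are the leaf's `mem_eigenClasses_six_iff` / `_four_iff` / `_three_iff`; the integral numbers were first computed by exact
  row reduction in HOME `widen/LIT-W/tools/mukai-g18/intfix.py` — the kernel proofs here are the second, independent
  method. Lattice arithmetic only: no object, sheaf or variety is asserted.
* End coordinates, every `g` (in section `IntegralFixedLattices`, any `CommRing R`): `fourier_mul_twist_mulVec_apply_last` :
  `(Ψ f)_g = ε f_0`; **`apply_last_eq_apply_zero_of_mulVec_eq`** : a `Ψ`-(anti-)fixed class (`Ψ f = ε f`) has `f_g = f_0`;
  `sum_choose_mul_apply_eq_of_mulVec_eq` : `Σ_k C(g,k) f_k = ε f_0`; **`dvd_mul_apply_zero_of_mulVec_eq`** : for `g ≥ 1`, if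
  `d ∣ C(g,k)` for all `0 < k < g` then `d ∣ (ε - 2) f_0` (`Σ_{0<k<g} C(g,k) f_k = (ε - 2) f_0`); hence over `ℤ`
  **`natCast_dvd_apply_zero_of_mulVec_eq_pow`** : for a PRIME POWER `g = p^a`, `p ≠ 3`, every integral `Ψ`-(anti-)fixed class
  has `p ∣ f_0` and `p ∣ f_g` (`p ∣ C(p^a,k)`, Mathlib `Nat.Prime.dvd_choose_pow`; `ε - 2 ∈ {-1, -3}`) — extending
  `natCast_dvd_apply_zero_of_mulVec_eq` (`g = p ≥ 5`) to `g = 2, 4, 8, 16, 25, …`; and `dvd_normSum_apply_zero_of_odd` : for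
  `g` odd such a `d` divides `(N_g u)_0` for EVERY `u` — at `g = 3^a` the functional `f ↦ f_0 mod 3` kills `N_g(ℤ^{g+1})` but not
  `Fix^ℤ_g` (`g = 3`: `(1,0,-1,1)`; `g = 9`: `b₁` below), which is the `ℤ/3` of those two cases. The law «`gcd` of the
  `e_0`-coordinates over `Fix^ℤ_g` = `gcd_{0<k<g} C(g,k)` except at the powers of `3`» was observed by machine for `g ≤ 60`
  (×2 across codes and seats) in HOME `widen/LIT-W/UTATE-EVERY-G-litw-mukai-g19.md` §2ter; the prime-power half is now a
  theorem for every `p^a`, `p ≠ 3`.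
* `g = 9 = 3²` (section `IntegralFixedLattices`, over `ℤ`; `fourier_mul_twist_mulVec_nine`, `normSum_nine` written out):
  **`fourier_mul_twist_mulVec_eq_neg_iff_nine`** : `Fix^ℤ₉ = ℤ b₁ ⊕ ℤ b₂ ⊕ ℤ b₃ ⊕ ℤ b₄`, `b₁ = (1,0,6,0,-14,23,-19,7,-1,1)`,
  `b₂ = (0,1,6,0,-15,25,-21,8,-1,0)`, `b₃ = (0,0,7,0,-16,26,-21,7,0,0)`, `b₄ = (0,0,0,1,-2,2,-1,0,0,0)` (rank `4 = famCard 9`;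
  `b₁` has `f_0 = 1`); **`exists_normSum_eq_iff_three_dvd_nine`** : `N₉(ℤ^10) = {f ∈ Fix^ℤ₉ : 3 ∣ f_0}`;
  `exists_normSum_eq_iff_nine` : `N₉(ℤ^10) = ℤ(3,0,4,0,-10,17,-15,7,-3,3) ⊕ ℤ b₂ ⊕ ℤ b₃ ⊕ ℤ b₄` (elementary divisors
  `(3,1,1,1)`: **`Fix^ℤ₉ / N₉(ℤ^10) ≅ ℤ/3`**, generated by `b₁`: `exists_normSum_eq_or_nine`, which also records that `b₁` is not
  a norm); `normSum_nine_examples` (`N₉(e₀) = (0,1,-1,1,-1,1,-1,1,-1,0)` and the basis preimages); `euler_nine_intBasis` (the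
  alternating `χ`-Gram of `b₁, …, b₄`: `-423, 252, 672, 756, 756, 756`).
* `g = 7`, the twin law (Tate `Ĥ⁻¹`): **`normSum_eq_zero_not_coboundary_seven`** — `u = (0,2,0,-1,0,1,0,0)` has `N₇ u = 0`
  and is NOT of the form `S T v + v`, `v ∈ ℤ^8`, while `3u` is (`v = (0,3,-2,3,-6,7,-3,0)`); the `g = 4` instance is
  `normSum_eq_zero_not_coboundary_four`. (Machine: `ker N_g / (εΨ - 1)ℤ^{g+1} ≅ ℤ/3` iff `g ≡ 1 (mod 3)`, `g ≤ 30` — NOT a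
  theorem of this file.)
* The Tate `Ĥ⁻¹` sandwich, every `g`, any `CommRing R` (section `IntegralFixedLattices`): `normSum_add` ∕ `normSum_smul` ∕
  `normSum_sub` (linearity), `normSum_fourier_mul_twist_mulVec` (`N_g(Ψv) = ε N_g v`), **`normSum_coboundary_eq_zero`**
  (`N_g(εΨv - v) = 0`: coboundaries have norm zero) and **`three_smul_mem_coboundary_of_normSum_eq_zero`** (`N_g v = 0 ⇒
  3v = εΨw - w` with `w = -(εΨv + 2v)`, since `(εΨ - 1)(εΨ + 2) = N_g - 3`): `(εΨ - 1)R^{g+1} ⊆ ker N_g ⊇ 3 ker N_g`-wise,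
  `ker N_g / (εΨ - 1)R^{g+1}` is an `𝔽₃`-space for every `g` — the twin of Lemma H; its non-vanishing over `ℤ` at `g = 4, 7`
  is `normSum_eq_zero_not_coboundary_four` ∕ `_seven`.
* Section `EisensteinCongruence` (any `CommRing R` with `ω² + ω + 1 = 0`; no `g`): `pow_six_sub_norm_cube_eq` — for
  `π = a + bω`, `π⁶ - (a² - ab + b²)³ = -ab(a-b)(1-ω)³π³`; **`nine_mul_one_sub_omega_dvd_pow_six_sub_norm_cube`** — for all
  integers `a, b`: `9(1-ω) ∣ (a + bω)⁶ - (a² - ab + b²)³`, i.e. **`π⁶ ≡ N(π)³ (mod 9λ)` in `ℤ[ζ₃]` for EVERY `π`** (HOME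
  `s4push/search-3/N6-TABLE-3.md` row U-EIS: there a theorem-candidate with hand proof ×2 and a machine box; here kernel, by
  the row's own route: `3 ∣ ab(a-b)` or `3 ∣ a+b`, `λ² = -3ω`, `3 = -ω²λ²`); instance `nine_mul_one_sub_root_dvd_pow_six_sub_norm_cube`
  in `ℤ[X]/(X² + X + 1)` and the SHARPNESS **`not_dvd_pow_six_sub_norm_cube_four_add_root`**: `27 ∤ (4 + ζ₃)⁶ - 13³`
  (`= -684 + 2520ζ₃`; constant coefficient of the normal form modulo the monic `X² + X + 1`, `684 = 27·25 + 9`), so `λ⁵`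
  is the exact power. The dictionary `λ = 1 - ω` prime, `3 = -ω²λ²`, units `±ω^i` is [IrelandRosen1990] Ch. 9 §1.
* Sections `ThetaScale` ∕ `NonprincipalCube` (every `g`, any `CommRing R`, every `n ∈ R`): `thetaScale R g c = diag(c^k)` (the
  substitution `θ ↦ cθ`; `D_{n²}` = the class of `n_X^*`) WITH BODY and its API (`thetaScale_mul_thetaScale`, `thetaScale_one`,
  `thetaScale_mulVec_thetaExp` `D_c e^{aθ} = e^{caθ}`, **`thetaScale_mul_twist`** `D_c T_a = T_{ca} D_c`,
  **`thetaScale_mul_fourier_mul_thetaScale`** `D_c S D_c = c^g S`); **`thetaScale_sq_mulVec_fourier_mulVec_thetaExp`** — the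
  class shadow of [Mukai1981] PROP 3.11 (1) «`φ_N^* N̂ ≅ (N^{-1})^{⊕|χ(N)|}`» for `N = 𝒪(nΘ)`: `D_{n²}(S e^{nθ}) = n^g e^{-nθ}`; and
  **`twist_mul_thetaScale_mul_fourier_pow_three`** — the class shadow of [Mukai1981] (3.12)
  «`(⊗N ∘ φ_N^* ∘ R𝒮̂)³[g + i(N)] ≅ (⊗𝒪^{⊕|χ(N)|}) ∘ φ_N^* ∘ φ_{N*}`» for `N = 𝒪(nΘ)`: **`(T_n D_{n²} S)³ = (-1)^g n^{3g} · 1`**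
  (`|χ(N)| = n^g`, `deg φ_N = n^{2g}`, `[g]` acting by `(-1)^g`; at `n = 1` the leaf's `twist_mul_fourier_pow_three`), proved by
  `M_n D_n = n^g D_n (T S)` over every ring, cancellation of `D_X` over the domain `ℤ[X]` and specialisation `X ↦ n`
  (`twist_mul_thetaScale_mul_fourier_pow_three_mul_thetaScale`, private `cube_law_X`, `RingHom.mapMatrix`).
* Section `SeedKernel` (every `g`, any `CommRing R`): `fourier_mul_twist_mulVec_thetaExp_apply` : `(Ψ e^{yθ})_m =
  (-1)^m (1+y)^{g-m}` with NO invertibility hypothesis (the leaf's `fourier_mul_twist_mulVec_thetaExp` is the field form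
  `(1+y)^g e^{-θ/(1+y)}`), and **`euler_thetaExp_fourier_mul_twist_mulVec_thetaExp`** : `χ(e^{xθ}, Ψ e^{yθ}) =
  (-1)^g (1 + x + xy)^g` (binomial theorem), `= (xy + x + 1)^6` at `g = 6` (`…_six`; HOME `s4push/search-3` N6-TABLE-3 row
  U-SEED-KER «`χ(𝒪(xΘ), Ψ𝒪(yΘ)) = (xy+x+1)⁶`», there hand ×1 + a `g = 6` machine check).
* Section `ThetaCoscale` (every `g`, any `CommRing R`): `thetaCoscale R g c = diag(c^{g-k})` (the class of `n_{X*}` for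
  `c = n²`) WITH BODY, `thetaCoscale_mul_thetaScale` ∕ `thetaScale_mul_thetaCoscale` (`E_c D_c = D_c E_c = c^g · 1`), and
  **`smul_fourier_mulVec_thetaExp_eq_thetaCoscale_mulVec`** — the class shadow of [Mukai1981] PROP 3.11 (2)
  «`N̂^{⊕|χ(N)|} ≅ φ_{N,*}N^{-1}`» for `N = 𝒪(nΘ)`: `n^g · S(e^{nθ}) = E_{n²} e^{-nθ}`. Section `Ram`: two divisor-form
  corollaries of B. Ram's theorem (1909) on `gcd_{0<k<n} C(n,k)` taken FROM MATHLIB (`Choose.gcd_choose_eq_minFac_of_isPrimePow`,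
  `Choose.gcd_choose_eq_one_of_not_isPrimePow`; nothing re-proved). Section `EndCoordinateImage` (the `N_g(ℤ^{g+1})` half of
  the `e₀`-gcd law, every `g ≥ 2`): `normSum_apply_zero_eq_sum`, `exists_normSum_apply_zero_eq_iff_gcd_dvd` (Bézout) and
  **`exists_normSum_apply_zero_eq_iff`**: `{(N_g u)₀ : u ∈ ℤ^{g+1}} = R(g)ℤ`, `R(g) = p` for `g = p^a`, `1` otherwise.
-/

namespace Literature.AlgebraicGeometry.AbelianVarieties

open Finset Matrix

namespace ThetaPowers

variable {R : Type*} [CommRing R]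

section GaussianShadows

/-! ### The integer shadows of the Gaussian slope: `S` is multiplication by `i^g` on `⟨(1,0,-1,0,…), (0,1,0,-1,…)⟩` -/

variable (g : ℕ)

variable (R) in
/-- The integer class `(1, 0, -1, 0, 1, 0, -1, …)`, `Re i^j`: `2 · gaussRe = e^{iθ} + e^{-iθ}`
(`two_smul_gaussRe_and_gaussIm`). [folklore] -/
def gaussRe : Fin (g + 1) → R := fun j => if (j : ℕ) % 4 = 0 then 1 else if (j : ℕ) % 4 = 2 then -1 else 0

variable (R) in
/-- The integer class `(0, 1, 0, -1, 0, 1, 0, …)`, `Im i^j`: `2 · gaussIm = (-i)(e^{iθ} - e^{-iθ})`. [folklore] -/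
def gaussIm : Fin (g + 1) → R := fun j => if (j : ℕ) % 4 = 1 then 1 else if (j : ℕ) % 4 = 3 then -1 else 0

/-- Entries of `gaussRe`. [folklore] -/
@[simp] private theorem gaussRe_apply (j : Fin (g + 1)) :
    gaussRe R g j = if (j : ℕ) % 4 = 0 then 1 else if (j : ℕ) % 4 = 2 then -1 else 0 := rfl

/-- Entries of `gaussIm`. [folklore] -/
@[simp] private theorem gaussIm_apply (j : Fin (g + 1)) :
    gaussIm R g j = if (j : ℕ) % 4 = 1 then 1 else if (j : ℕ) % 4 = 3 then -1 else 0 := rfl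

section WithI

variable {I : R} (hI : I ^ 2 = -1)
include hI

/-- `i^n = i^{n mod 4}`. [folklore] -/
private theorem I_pow_mod_four (n : ℕ) : I ^ n = I ^ (n % 4) := by
  have h4 : I ^ 4 = 1 := by rw [show (4 : ℕ) = 2 * 2 from rfl, pow_mul, hI, neg_one_sq]
  calc I ^ n = I ^ (4 * (n / 4) + n % 4) := by rw [Nat.div_add_mod]
    _ = I ^ (n % 4) := by rw [pow_add, pow_mul, h4, one_pow, one_mul]

/-- `2 Re e^{iθ} = e^{iθ} + e^{-iθ}` and `2 Im e^{iθ} = (-i)(e^{iθ} - e^{-iθ})` coordinatewise (`i^j + (-i)^j`,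
`(-i)(i^j - (-i)^j)` for `j mod 4 = 0, 1, 2, 3`). [cite: Fulton1998, Example 3.2.3 (p. 56)] -/
theorem two_smul_gaussRe_and_gaussIm :
    (2 : R) • gaussRe R g = thetaExp R g I + thetaExp R g (-I) ∧
    (2 : R) • gaussIm R g = (-I) • (thetaExp R g I - thetaExp R g (-I)) := by
  have hI' : (-I) ^ 2 = -1 := by rw [neg_sq, hI]
  constructor
  · ext j
    rw [Pi.smul_apply, Pi.add_apply, thetaExp_apply, thetaExp_apply, gaussRe_apply, smul_eq_mul,
      I_pow_mod_four hI (j : ℕ), I_pow_mod_four hI' (j : ℕ)]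
    rcases (by omega : (j : ℕ) % 4 = 0 ∨ (j : ℕ) % 4 = 1 ∨ (j : ℕ) % 4 = 2 ∨ (j : ℕ) % 4 = 3) with h | h | h | h <;>
      rw [h]
    · rw [if_pos rfl, pow_zero, pow_zero]; norm_num
    · rw [if_neg (by omega), if_neg (by omega), pow_one, pow_one]; ring
    · rw [if_neg (by omega), if_pos rfl]; linear_combination (-2 : R) * hI
    · rw [if_neg (by omega), if_neg (by omega)]; ring
  · ext j
    rw [Pi.smul_apply, Pi.smul_apply, Pi.sub_apply, thetaExp_apply, thetaExp_apply, gaussIm_apply, smul_eq_mul,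
      smul_eq_mul, I_pow_mod_four hI (j : ℕ), I_pow_mod_four hI' (j : ℕ)]
    rcases (by omega : (j : ℕ) % 4 = 0 ∨ (j : ℕ) % 4 = 1 ∨ (j : ℕ) % 4 = 2 ∨ (j : ℕ) % 4 = 3) with h | h | h | h <;>
      rw [h]
    · rw [if_neg (by omega), if_neg (by omega), pow_zero, pow_zero]; ring
    · rw [if_pos rfl, pow_one, pow_one]; linear_combination (2 : R) * hI
    · rw [if_neg (by omega), if_neg (by omega)]; ring
    · rw [if_neg (by omega), if_pos rfl]; linear_combination (2 * (I ^ 2 - 1)) * hI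

end WithI

/-- One coordinate of `S` with the sign read off `m mod 2`: `(S v)_m = (-1)^{m mod 2} v_{g-m}`. [folklore] -/
private theorem fourier_mulVec_apply_mod_two (v : Fin (g + 1) → R) (m : Fin (g + 1)) :
    (fourier R g *ᵥ v) m = (-1 : R) ^ ((m : ℕ) % 2) * v (Fin.rev m) := by
  rw [fourier_mulVec, neg_one_pow_eq_pow_mod_two]

/-- `(rev m : ℕ) = g - m` on `Fin (g + 1)`. [folklore] -/
private theorem val_rev_eq (m : Fin (g + 1)) : ((Fin.rev m : Fin (g + 1)) : ℕ) = g - m := by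
  rw [Fin.val_rev]; omega

/-- **`S` on the Gaussian integer classes, every `g`, every commutative ring**: with `a = Re i^g`, `b = Im i^g` (the last
entries `gaussRe g g`, `gaussIm g g`), `S · gaussRe = a · gaussRe - b · gaussIm` and `S · gaussIm = b · gaussRe + a · gaussIm`
— `S` preserves the plane `⟨(1,0,-1,0,…), (0,1,0,-1,…)⟩` and acts on it as multiplication by `i^g`: the identity for
`4 ∣ g` (two `S`-FIXED integer classes), `-1` for `g ≡ 2 (mod 4)`, the rotations `± i` for `g` odd. (Read off
`(S v)_m = (-1)^m v_{g-m}`.) [cite: Beauville1983FourierChow, Prop. 5 (p. 248)] [cite: Mukai1981, Thm. 3.13 (1), (5) (p. 163)] -/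
theorem fourier_mulVec_gaussRe_gaussIm :
    fourier R g *ᵥ gaussRe R g = gaussRe R g (Fin.last g) • gaussRe R g - gaussIm R g (Fin.last g) • gaussIm R g ∧
    fourier R g *ᵥ gaussIm R g = gaussIm R g (Fin.last g) • gaussRe R g + gaussRe R g (Fin.last g) • gaussIm R g := by
  constructor
  all_goals
    ext m
    simp only [fourier_mulVec_apply_mod_two, Pi.sub_apply, Pi.add_apply, Pi.smul_apply, smul_eq_mul, gaussRe_apply,
      gaussIm_apply, Fin.val_last, val_rev_eq]
    have h1 : (m : ℕ) ≤ g := m.is_le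
    have e : (g - (m : ℕ)) % 4 = (g % 4 + 4 - (m : ℕ) % 4) % 4 := by omega
    have p : (m : ℕ) % 2 = (m : ℕ) % 4 % 2 := by omega
    rcases (by omega : g % 4 = 0 ∨ g % 4 = 1 ∨ g % 4 = 2 ∨ g % 4 = 3) with hg | hg | hg | hg <;>
    rcases (by omega : (m : ℕ) % 4 = 0 ∨ (m : ℕ) % 4 = 1 ∨ (m : ℕ) % 4 = 2 ∨ (m : ℕ) % 4 = 3) with hm | hm | hm | hm <;>
    · rw [hg, hm] at e
      rw [hm] at p
      norm_num at e p
      simp only [e, p, hg, hm]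
      norm_num

/-- The Gaussian classes at `g = 4` and `g = 6` written out: `(1,0,-1,0,1)`, `(0,1,0,-1,0)` (both `S`-fixed at `g = 4`)
and `(1,0,-1,0,1,0,-1)`, `(0,1,0,-1,0,1,0)` (both `S`-anti-fixed at `g = 6`). [cite: Beauville1983FourierChow, Prop. 5 (p. 248)] -/
theorem gaussRe_gaussIm_four_six :
    gaussRe R 4 = ![1, 0, -1, 0, 1] ∧ gaussIm R 4 = ![0, 1, 0, -1, 0] ∧
    gaussRe R 6 = ![1, 0, -1, 0, 1, 0, -1] ∧ gaussIm R 6 = ![0, 1, 0, -1, 0, 1, 0] := by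
  refine ⟨?_, ?_, ?_, ?_⟩ <;> ext j <;> fin_cases j <;> simp

end GaussianShadows

section ZetaSixPlane

/-! ### `⊗L` carries the `ζ₃`-plane `⟨c, s⟩` to the `ζ₆`-plane `⟨c^∨, -s^∨⟩`, every `g`, every ring -/

variable (g : ℕ)

/-- `dualVec` is additive. [folklore] -/
private theorem dualVec_add (u v : Fin (g + 1) → R) : dualVec R g (u + v) = dualVec R g u + dualVec R g v := by
  ext j; simp only [dualVec_apply, Pi.add_apply, mul_add]

/-- `dualVec` commutes with subtraction. [folklore] -/
private theorem dualVec_sub (u v : Fin (g + 1) → R) : dualVec R g (u - v) = dualVec R g u - dualVec R g v := by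
  ext j; simp only [dualVec_apply, Pi.sub_apply, mul_sub]

/-- `dualVec` commutes with scalars. [folklore] -/
private theorem dualVec_smul (a : R) (v : Fin (g + 1) → R) : dualVec R g (a • v) = a • dualVec R g v := by
  ext j; simp only [dualVec_apply, Pi.smul_apply, smul_eq_mul, mul_left_comm]

section WithOmega

variable {ω : R} (hω : ω ^ 2 + ω + 1 = 0)
include hω

/-- Over a ring with `ω`: `T c = c^∨` (`T e^{ωθ} = e^{-ω²θ} = (e^{ω²θ})^∨`, `T e^{ω²θ} = e^{-ωθ} = (e^{ωθ})^∨`).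
[cite: Mukai1987FourierFunctor, (1.19) (p. 527)] -/
private theorem twist_mulVec_omegaRe_of_root : twist R g 1 *ᵥ omegaRe R g = dualVec R g (omegaRe R g) := by
  rw [omegaRe_eq_thetaExp_add_thetaExp g hω, Matrix.mulVec_add, twist_mulVec_thetaExp, twist_mulVec_thetaExp,
    dualVec_add, dualVec_thetaExp, dualVec_thetaExp, show (1 : R) + ω = -ω ^ 2 by linear_combination hω,
    show (1 : R) + ω ^ 2 = -ω by linear_combination hω]
  exact add_comm _ _

/-- Over a ring with `ω`: `T (3s) = -(3s)^∨`. [cite: Mukai1987FourierFunctor, (1.19) (p. 527)] -/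
private theorem twist_mulVec_three_smul_omegaIm_of_root :
    twist R g 1 *ᵥ ((3 : R) • omegaIm R g) = -dualVec R g ((3 : R) • omegaIm R g) := by
  rw [three_smul_omegaIm g hω, Matrix.mulVec_smul, Matrix.mulVec_sub, twist_mulVec_thetaExp, twist_mulVec_thetaExp,
    dualVec_smul, dualVec_sub, dualVec_thetaExp, dualVec_thetaExp, show (1 : R) + ω = -ω ^ 2 by linear_combination hω,
    show (1 : R) + ω ^ 2 = -ω by linear_combination hω, ← smul_neg, neg_sub]

end WithOmega

section Transfer

open Polynomial

variable {S : Type*} [CommRing S] (φ : R →+* S)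

/-- `T` commutes with ring maps. [cite: Fulton1998, Example 3.2.3 (p. 56)] -/
private theorem map_twist_one : (twist R g 1).map φ = twist S g 1 := by
  ext m k
  simp only [Matrix.map_apply, twist_apply, map_mul, map_natCast, map_pow, map_one]

/-- `T` commutes with ring maps on column vectors. [folklore] -/
private theorem comp_twist_mulVec (v : Fin (g + 1) → R) : φ ∘ (twist R g 1 *ᵥ v) = twist S g 1 *ᵥ (φ ∘ v) := by
  ext i
  rw [Function.comp_apply, RingHom.map_mulVec, map_twist_one]

/-- `dualVec` commutes with ring maps. [folklore] -/
private theorem comp_dualVec (v : Fin (g + 1) → R) : φ ∘ dualVec R g v = dualVec S g (φ ∘ v) := by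
  ext j
  simp only [Function.comp_apply, dualVec_apply, map_mul, map_pow, map_neg, map_one]

/-- `c`, `s` commute with ring maps. [folklore] -/
private theorem comp_omegaRe_omegaIm : φ ∘ omegaRe R g = omegaRe S g ∧ φ ∘ omegaIm R g = omegaIm S g := by
  constructor <;> ext j <;> simp only [Function.comp_apply, omegaRe, omegaIm, apply_ite φ, map_ofNat, map_neg, map_one,
    map_zero]

/-- The class of `X` in `ℤ[X]/(X² + X + 1)` satisfies `ω² + ω + 1 = 0`. [folklore] -/
private theorem root_sq_add_root_add_one :
    AdjoinRoot.root (X ^ 2 + X + 1 : ℤ[X]) ^ 2 + AdjoinRoot.root (X ^ 2 + X + 1 : ℤ[X]) + 1 = 0 := by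
  have h := AdjoinRoot.eval₂_root (X ^ 2 + X + 1 : ℤ[X])
  rwa [eval₂_add, eval₂_add, eval₂_pow, eval₂_X, eval₂_one] at h

/-- `ℤ → ℤ[X]/(X² + X + 1)` is injective. [folklore] -/
private theorem of_injective : Function.Injective (AdjoinRoot.of (X ^ 2 + X + 1 : ℤ[X])) := by
  refine AdjoinRoot.of.injective_of_degree_ne_zero fun h => ?_
  have h2 : (X ^ 2 + X + 1 : ℤ[X]).natDegree = 2 := by compute_degree!
  have h0 : (X ^ 2 + X + 1 : ℤ[X]).natDegree = 0 := Polynomial.natDegree_eq_zero_iff_degree_le_zero.mpr h.le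
  omega

/-- Over `ℤ`: `T c = c^∨` and `T s = -s^∨`. [cite: Mukai1987FourierFunctor, (1.19) (p. 527)] -/
private theorem twist_mulVec_omegaRe_omegaIm_int :
    twist ℤ g 1 *ᵥ omegaRe ℤ g = dualVec ℤ g (omegaRe ℤ g) ∧ twist ℤ g 1 *ᵥ omegaIm ℤ g = -dualVec ℤ g (omegaIm ℤ g) := by
  have hφ := of_injective
  set φ := AdjoinRoot.of (X ^ 2 + X + 1 : ℤ[X]) with hφdef
  constructor
  · apply hφ.comp_left
    show φ ∘ _ = φ ∘ _
    rw [comp_twist_mulVec, comp_dualVec, (comp_omegaRe_omegaIm g φ).1,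
      twist_mulVec_omegaRe_of_root g root_sq_add_root_add_one]
  · have h : twist ℤ g 1 *ᵥ ((3 : ℤ) • omegaIm ℤ g) = -dualVec ℤ g ((3 : ℤ) • omegaIm ℤ g) := by
      apply hφ.comp_left
      show φ ∘ _ = φ ∘ _
      have e : φ ∘ ((3 : ℤ) • omegaIm ℤ g) = (3 : AdjoinRoot (X ^ 2 + X + 1 : ℤ[X])) • omegaIm _ g := by
        rw [← (comp_omegaRe_omegaIm g φ).2]
        ext i
        simp only [Function.comp_apply, Pi.smul_apply, smul_eq_mul, map_mul, map_ofNat]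
      have e' : ∀ w : Fin (g + 1) → ℤ, φ ∘ (-w) = -(φ ∘ w) := fun w => by
        ext i; simp only [Function.comp_apply, Pi.neg_apply, map_neg]
      rw [comp_twist_mulVec, e', comp_dualVec, e, twist_mulVec_three_smul_omegaIm_of_root g root_sq_add_root_add_one]
    rw [Matrix.mulVec_smul, dualVec_smul, ← smul_neg] at h
    exact smul_right_injective (Fin (g + 1) → ℤ) (by norm_num : (3 : ℤ) ≠ 0) h

end Transfer

/-- **`⊗L` carries the `ζ₃`-plane to the `ζ₆`-plane, every `g`, every commutative ring**: `T c = c^∨ = (2, 1, -1, -2, -1, 1,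
2, …)` and `T s = -s^∨ = (0, 1, 1, 0, -1, -1, 0, …)` (`c^∨ = dualVec c`: `e_k ↦ (-1)^k e_k`). So HOME `widen/W5`'s plane
`V_{ζ₆} = ⟨Re φ(ζ₆), Im φ(ζ₆)⟩` is `T · ⟨c, s⟩`, and the «sign convention `e_k ↦ (-1)^k e_k`» between the two records
of the `g = 6` plane is the twist by `L`. [cite: Mukai1987FourierFunctor, (1.19) (p. 527)] [cite: Fulton1998, Example 3.2.3 (p. 56)] -/
theorem twist_mulVec_omegaRe_omegaIm :
    twist R g 1 *ᵥ omegaRe R g = dualVec R g (omegaRe R g) ∧ twist R g 1 *ᵥ omegaIm R g = -dualVec R g (omegaIm R g) := by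
  obtain ⟨h1, h2⟩ := twist_mulVec_omegaRe_omegaIm_int g
  have k1 := congrArg (fun v => (Int.castRingHom R) ∘ v) h1
  have k2 := congrArg (fun v => (Int.castRingHom R) ∘ v) h2
  have e' : ∀ w : Fin (g + 1) → ℤ, (Int.castRingHom R) ∘ (-w) = -((Int.castRingHom R) ∘ w) := fun w => by
    ext i; simp only [Function.comp_apply, Pi.neg_apply, map_neg]
  simp only [comp_twist_mulVec, comp_dualVec, (comp_omegaRe_omegaIm g (Int.castRingHom R)).1,
    (comp_omegaRe_omegaIm g (Int.castRingHom R)).2, e'] at k1 k2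
  exact ⟨k1, k2⟩

/-- **The `ζ₆`-plane is the `(-1)^g`-eigenplane of `T S` when `3 ∣ g`**, over every commutative ring: `T S c^∨ = (-1)^g c^∨`
and `T S s^∨ = (-1)^g s^∨` (`c^∨ = (2,1,-1,-2,…)`, `s^∨ = (0,-1,1,0,…)`) — the leaf's
`twist_mul_fourier_mulVec_twist_omegaRe_omegaIm` rewritten through `twist_mulVec_omegaRe_omegaIm`.
[cite: Mukai1981, Thm. 3.13 (5)–(6) and (3.14) (p. 163)] -/
theorem twist_mul_fourier_mulVec_dualVec_omegaRe_omegaIm (h3 : 3 ∣ g) :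
    (twist R g 1 * fourier R g) *ᵥ dualVec R g (omegaRe R g) = (-1 : R) ^ g • dualVec R g (omegaRe R g) ∧
    (twist R g 1 * fourier R g) *ᵥ dualVec R g (omegaIm R g) = (-1 : R) ^ g • dualVec R g (omegaIm R g) := by
  obtain ⟨hc, hs⟩ := twist_mulVec_omegaRe_omegaIm (R := R) g
  obtain ⟨h1, h2⟩ := twist_mul_fourier_mulVec_twist_omegaRe_omegaIm (R := R) g h3
  rw [hc] at h1
  rw [hs, Matrix.mulVec_neg, smul_neg, neg_inj] at h2
  exact ⟨h1, h2⟩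

/-- The `ζ₆`-plane at `g = 6` written out: `c^∨ = (2,1,-1,-2,-1,1,2)`, `-s^∨ = (0,1,1,0,-1,-1,0)` — the vectors
`∝ Re φ(ζ₆)`, `∝ Im φ(ζ₆)` of HOME `widen/W5` TABLE-W5-N6; both `T S`-fixed. [cite: Mukai1981, Thm. 3.13 (6) and (3.14) (p. 163)] -/
theorem dualVec_omegaRe_omegaIm_six :
    dualVec R 6 (omegaRe R 6) = ![2, 1, -1, -2, -1, 1, 2] ∧ -dualVec R 6 (omegaIm R 6) = ![0, 1, 1, 0, -1, -1, 0] := by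
  constructor <;> ext j <;> fin_cases j <;> norm_num [omegaRe, omegaIm]

end ZetaSixPlane

section IntegralFixedLattices

/-! ### The integral `Ψ^H`-(anti-)fixed lattice `Fix^ℤ_g = ker_ℤ(S T - ε)` and the norm sublattice `N_g(ℤ^{g+1})`,
`N_g = 1 + ε S T + (S T)²`, written out at `g = 3, 4, 5, 6, 7, 9` (index `3`, `1`, `1`, `3`, `1`, `3`); the end-coordinate
law `f_g = f_0`, `gcd_{0<k<g} C(g,k) ∣ (ε - 2) f_0` for every `g`; the Tate `Ĥ⁻¹` instances at `g = 4, 7` -/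

variable (g : ℕ)

/-- Coordinates of `Ψ^H f = S T f`: `(S T f)_m = (-1)^m Σ_k C(g - m, k) f_k` (first `T = ·e^θ`, then
`(S v)_m = (-1)^m v_{g-m}`). [cite: Mukai1981, Thm. 3.13 (5)–(6) and (3.14) (p. 163)]
[cite: Beauville1983FourierChow, Prop. 5 (p. 248)] -/
theorem fourier_mul_twist_mulVec_apply (f : Fin (g + 1) → R) (m : Fin (g + 1)) :
    ((fourier R g * twist R g 1) *ᵥ f) m =
      (-1 : R) ^ (m : ℕ) * ∑ k : Fin (g + 1), (((g - (m : ℕ)).choose k : ℕ) : R) * f k := by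
  rw [← Matrix.mulVec_mulVec, fourier_mulVec]
  congr 1
  rw [Matrix.mulVec, dotProduct]
  refine Finset.sum_congr rfl fun k _ => ?_
  rw [twist_apply, one_pow, mul_one, val_rev_eq]

variable (R)

/-- The norm map of the order-`3` element `ε Ψ^H` (`Ψ^H = S T`, `ε = (-1)^g`, `(ε Ψ^H)³ = 1` by
`fourier_mul_twist_pow_three`): `N_g v := v + ε Ψ^H v + (Ψ^H)² v` — the orbit sum of
`fourier_mul_twist_mulVec_orbitSum`. [cite: Mukai1981, Thm. 3.13 (6) and (3.14) (p. 163)] -/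
def normSum (v : Fin (g + 1) → R) : Fin (g + 1) → R :=
  v + (-1 : R) ^ g • (fourier R g * twist R g 1) *ᵥ v + ((fourier R g * twist R g 1) ^ 2) *ᵥ v

variable {R}

/-- Unfolding `normSum`: `N_g v = v + ε Ψ v + Ψ (Ψ v)` (the orbit sum of the order-`3` element `ε Ψ` of
[Mukai1981] Thm. 3.13 (6) ∕ (3.14) on classes). [cite: Mukai1981, Thm. 3.13 (6) and (3.14) (p. 163)] -/
theorem normSum_eq (v : Fin (g + 1) → R) :
    normSum R g v = v + (-1 : R) ^ g • (fourier R g * twist R g 1) *ᵥ v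
      + (fourier R g * twist R g 1) *ᵥ ((fourier R g * twist R g 1) *ᵥ v) := by
  rw [normSum, pow_two, Matrix.mulVec_mulVec]

/-- **Norms are `ε`-eigenclasses, every `g`**: `Ψ^H (N_g v) = ε N_g v` (`fourier_mul_twist_mulVec_orbitSum`), so
`N_g(ℤ^{g+1}) ⊆ Fix^ℤ_g := ker_ℤ(S T - ε)`. [cite: Mukai1981, Thm. 3.13 (6) and (3.14) (p. 163)] -/
theorem fourier_mul_twist_mulVec_normSum (v : Fin (g + 1) → R) :
    (fourier R g * twist R g 1) *ᵥ normSum R g v = (-1 : R) ^ g • normSum R g v :=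
  fourier_mul_twist_mulVec_orbitSum g v

/-- **Lemma H** (every `g`, every commutative ring): a `Ψ^H`-fixed class `f` (`S T f = ε f`, `ε = (-1)^g`) has norm
`N_g f = f + ε Ψ f + Ψ² f = 3 f`; with `fourier_mul_twist_mulVec_normSum` this is `3 · Fix_g ⊆ N_g(L) ⊆ Fix_g` for the
lattice `L = R^{g+1}`, so `Fix_g / N_g(L)` is an `𝔽₃`-vector space. [cite: Mukai1981, Thm. 3.13 (6) and (3.14) (p. 163)] -/
theorem normSum_eq_three_smul_of_mulVec_eq {f : Fin (g + 1) → R}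
    (h : (fourier R g * twist R g 1) *ᵥ f = (-1 : R) ^ g • f) : normSum R g f = (3 : R) • f := by
  have hε : (-1 : R) ^ g * (-1 : R) ^ g = 1 := by rw [← mul_pow, neg_one_mul, neg_neg, one_pow]
  rw [normSum_eq, h, Matrix.mulVec_smul, h, smul_smul, hε, one_smul,
    show (3 : R) = 1 + 1 + 1 by norm_num, add_smul, add_smul, one_smul]

/-- The `e₀`-coordinate of `Ψ^H f`: `(S T f)_0 = Σ_k C(g, k) f_k` (row `0` of `S` is `e_g`, row `g` of `T` is
`(C(g,k))_k`). [cite: Mukai1981, Thm. 3.13 (5)–(6) and (3.14) (p. 163)] -/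
theorem fourier_mul_twist_mulVec_apply_zero (f : Fin (g + 1) → R) :
    ((fourier R g * twist R g 1) *ᵥ f) 0 = ∑ k : Fin (g + 1), ((g.choose k : ℕ) : R) * f k := by
  rw [fourier_mul_twist_mulVec_apply, Fin.val_zero, pow_zero, one_mul, Nat.sub_zero]

/-- The `e₀`-coordinate of `(Ψ^H)² f` is `f_g`: `(S T S T f)_0 = (U f)_g` with `U = T S T` the cotwist (entry
`C(g - m, g - k)`), and row `g` of `U` is `e_g`. [cite: Mukai1981, Thm. 3.13 (1), (6) and (3.14) (p. 163)] -/
theorem fourier_mul_twist_mulVec_mulVec_apply_zero (f : Fin (g + 1) → R) :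
    ((fourier R g * twist R g 1) *ᵥ ((fourier R g * twist R g 1) *ᵥ f)) 0 = f (Fin.last g) := by
  rw [Matrix.mulVec_mulVec, show fourier R g * twist R g 1 * (fourier R g * twist R g 1) =
      fourier R g * (twist R g 1 * fourier R g * twist R g 1) by simp only [Matrix.mul_assoc],
    twist_mul_fourier_mul_twist, ← Matrix.mulVec_mulVec, fourier_mulVec, Fin.val_zero, pow_zero, one_mul,
    Fin.rev_zero, Matrix.mulVec, dotProduct]
  rw [Finset.sum_eq_single (Fin.last g)]
  · rw [cotwist, Matrix.of_apply, Fin.val_last, Nat.sub_self, Nat.choose_zero_right, Nat.cast_one, one_mul]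
  · intro k _ hk
    rw [cotwist, Matrix.of_apply, Fin.val_last, Nat.sub_self,
      Nat.choose_eq_zero_of_lt (by have := k.is_le; have : (k : ℕ) ≠ g := fun e => hk (Fin.ext (by
        rw [Fin.val_last]; exact e)); omega), Nat.cast_zero, zero_mul]
  · intro h; exact absurd (Finset.mem_univ _) h

/-- **The `e₀`-coordinate of a norm, every `g`**: `(N_g f)_0 = f_0 + ε Σ_k C(g,k) f_k + f_g` — row `0` of
`N_g = 1 + ε Ψ + Ψ²` is `δ_0 + δ_g + ε (C(g,k))_k`; so over `ℤ` the `e₀`-coordinates of `N_g(ℤ^{g+1})` form the ideal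
`gcd(1 + ε, gcd_{0<k<g} C(g,k)) ℤ`. [cite: Mukai1981, Thm. 3.13 (6) and (3.14) (p. 163)] -/
theorem normSum_apply_zero (f : Fin (g + 1) → R) :
    normSum R g f 0 = f 0 + (-1 : R) ^ g * ∑ k : Fin (g + 1), ((g.choose k : ℕ) : R) * f k + f (Fin.last g) := by
  rw [normSum_eq, Pi.add_apply, Pi.add_apply, Pi.smul_apply, smul_eq_mul, fourier_mul_twist_mulVec_apply_zero,
    fourier_mul_twist_mulVec_mulVec_apply_zero]

/-- **For a prime `p ≥ 5`, the `e₀`-coordinate of every integral `Ψ^H`-anti-fixed theta-power class of a `p`-fold is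
divisible by `p`** (`g = p` odd, `ε = -1`; the cases `p = 5, 7` are the `5ℤ` ∕ `7ℤ` of
`fourier_mul_twist_mulVec_eq_neg_iff_five` ∕ `_seven`): by Lemma H `3 f = N_p f`, and `(N_p f)_0 = f_0 - Σ_k C(p,k) f_k + f_p
≡ -(terms with 0 < k < p) ≡ 0 (mod p)`, so `p ∣ 3 f_0`, and `p ≠ 3`. [cite: Mukai1981, Thm. 3.13 (6) and (3.14) (p. 163)] -/
theorem natCast_dvd_apply_zero_of_mulVec_eq {p : ℕ} (hp : p.Prime) (h2 : p ≠ 2) (h3 : p ≠ 3) {f : Fin (p + 1) → ℤ}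
    (h : (fourier ℤ p * twist ℤ p 1) *ᵥ f = (-1 : ℤ) ^ p • f) : (p : ℤ) ∣ f 0 := by
  have hN := congr_fun (normSum_eq_three_smul_of_mulVec_eq p h) 0
  rw [normSum_apply_zero, Pi.smul_apply, smul_eq_mul, (hp.odd_of_ne_two h2).neg_one_pow, neg_one_mul] at hN
  -- hN : f 0 + -∑ k, C(p,k) f k + f (last p) = 3 * f 0
  have hlast : (0 : Fin (p + 1)) ≠ Fin.last p := by
    intro e; have := congrArg Fin.val e; rw [Fin.val_zero, Fin.val_last] at this; exact hp.ne_zero this.symm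
  have hterm : ∀ k : Fin (p + 1), (p : ℤ) ∣ ((p.choose k : ℕ) : ℤ) * f k -
      ((if k = 0 then f k else 0) + (if k = Fin.last p then f k else 0)) := by
    intro k
    by_cases hk0 : k = 0
    · subst hk0
      rw [if_pos rfl, if_neg hlast, Fin.val_zero, Nat.choose_zero_right, Nat.cast_one, one_mul, add_zero, sub_self]
      exact dvd_zero _
    by_cases hkl : k = Fin.last p
    · subst hkl
      rw [if_neg hlast.symm, if_pos rfl, Fin.val_last, Nat.choose_self, Nat.cast_one, one_mul, zero_add, sub_self]
      exact dvd_zero _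
    · rw [if_neg hk0, if_neg hkl, add_zero, sub_zero]
      refine Dvd.dvd.mul_right ?_ _
      have hk0' : (k : ℕ) ≠ 0 := fun e => hk0 (Fin.ext (by rw [Fin.val_zero]; exact e))
      have hkp : (k : ℕ) < p := lt_of_le_of_ne (Nat.le_of_lt_succ k.isLt)
        (fun e => hkl (Fin.ext (by rw [Fin.val_last]; exact e)))
      exact_mod_cast hp.dvd_choose_self hk0' hkp
  have hsum := Finset.dvd_sum fun k (_ : k ∈ (Finset.univ : Finset (Fin (p + 1)))) => hterm k
  rw [Finset.sum_sub_distrib, Finset.sum_add_distrib, Finset.sum_ite_eq' Finset.univ (0 : Fin (p + 1)),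
    Finset.sum_ite_eq' Finset.univ (Fin.last p), if_pos (Finset.mem_univ _), if_pos (Finset.mem_univ _)] at hsum
  -- hsum : p ∣ ∑ C f - (f 0 + f last)
  have h3f : (p : ℤ) ∣ 3 * f 0 := by
    have e : 3 * f 0 = -(∑ k : Fin (p + 1), ((p.choose k : ℕ) : ℤ) * f k - (f 0 + f (Fin.last p))) := by linarith
    rw [e]; exact hsum.neg_right
  have hpZ : Prime (p : ℤ) := Nat.prime_iff_prime_int.mp hp
  rcases hpZ.dvd_or_dvd h3f with hd3 | hf
  · exfalso
    have : p ∣ 3 := by exact_mod_cast hd3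
    exact h3 ((Nat.prime_dvd_prime_iff_eq hp Nat.prime_three).mp this)
  · exact hf

/-! #### The Tate `Ĥ⁻¹` sandwich, every `g`: coboundaries `(εΨ - 1)v` have norm zero, and `3 · ker N_g ⊆ (εΨ - 1) R^{g+1}` -/


/-- `N_g` is additive. [cite: Mukai1981, Thm. 3.13 (6) and (3.14) (p. 163)] -/
theorem normSum_add (u v : Fin (g + 1) → R) : normSum R g (u + v) = normSum R g u + normSum R g v := by
  simp only [normSum, Matrix.mulVec_add, smul_add]
  abel

/-- `N_g` commutes with scalars. [cite: Mukai1981, Thm. 3.13 (6) and (3.14) (p. 163)] -/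
theorem normSum_smul (a : R) (v : Fin (g + 1) → R) : normSum R g (a • v) = a • normSum R g v := by
  simp only [normSum, Matrix.mulVec_smul, smul_add, smul_comm a ((-1 : R) ^ g)]

/-- `N_g` is compatible with subtraction. [cite: Mukai1981, Thm. 3.13 (6) and (3.14) (p. 163)] -/
theorem normSum_sub (u v : Fin (g + 1) → R) : normSum R g (u - v) = normSum R g u - normSum R g v := by
  simp only [normSum, Matrix.mulVec_sub, smul_sub]
  abel

/-- **`N_g ∘ Ψ = ε N_g`, every `g`**: `N_g(S T v) = ε N_g(v)` (from `(S T)³ = ε`), so `N_g` commutes with `εΨ` — the norm of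
the order-`3` element `ε S T`. [cite: Mukai1981, Thm. 3.13 (6) and (3.14) (p. 163)] -/
theorem normSum_fourier_mul_twist_mulVec (v : Fin (g + 1) → R) :
    normSum R g ((fourier R g * twist R g 1) *ᵥ v) = (-1 : R) ^ g • normSum R g v := by
  have h3 : fourier R g * twist R g 1 * (fourier R g * twist R g 1) * (fourier R g * twist R g 1) =
      (-1 : R) ^ g • (1 : Matrix (Fin (g + 1)) (Fin (g + 1)) R) := by
    rw [← pow_three', fourier_mul_twist_pow_three]
  have hsq : ((-1 : R) ^ g) * ((-1 : R) ^ g) = 1 := by rw [← pow_add, ← two_mul, pow_mul, neg_one_sq, one_pow]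
  simp only [normSum, pow_two, Matrix.mulVec_mulVec]
  rw [h3, Matrix.smul_mulVec, Matrix.one_mulVec, smul_add, smul_add, smul_smul, hsq, one_smul]
  abel

/-- **Coboundaries have norm zero, every `g`** (the trivial half of Tate `Ĥ⁻¹` for the order-`3` element `εΨ = ε S T`):
`N_g(εΨ v - v) = 0` for every class `v` — `N_g (εΨ - 1) = (εΨ)³ - 1 = 0`. Over `ℤ` at `g = 4, 7` the converse
inclusion `ker N_g ⊆ (εΨ - 1)ℤ^{g+1}` FAILS by a `ℤ/3` (`normSum_eq_zero_not_coboundary_four` ∕ `_seven`), while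
`three_smul_mem_coboundary_of_normSum_eq_zero` gives `3 · ker N_g ⊆ (εΨ - 1) R^{g+1}` for every `g`.
[cite: Mukai1981, Thm. 3.13 (6) and (3.14) (p. 163)] -/
theorem normSum_coboundary_eq_zero (v : Fin (g + 1) → R) :
    normSum R g ((-1 : R) ^ g • (fourier R g * twist R g 1) *ᵥ v - v) = 0 := by
  have hsq : ((-1 : R) ^ g) * ((-1 : R) ^ g) = 1 := by rw [← pow_add, ← two_mul, pow_mul, neg_one_sq, one_pow]
  rw [normSum_sub, normSum_smul, normSum_fourier_mul_twist_mulVec, smul_smul, hsq, one_smul, sub_self]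

/-- **`Ĥ⁻¹` is `3`-torsion, every `g`, every commutative ring** (the twin of Lemma H `normSum_eq_three_smul_of_mulVec_eq`):
if `N_g v = 0` then `3 v = εΨ w - w` with `w = -(εΨ v + 2 v)` — because `(εΨ - 1)(εΨ + 2) = (εΨ)² + εΨ - 2 = N_g - 3`. So
`(εΨ - 1) R^{g+1} ⊆ ker N_g` (`normSum_coboundary_eq_zero`) `⊇ 3 · ker N_g`, and `ker N_g / (εΨ - 1)R^{g+1}` is an
`𝔽₃`-vector space (over `ℤ`: `ℤ/3` at `g = 4, 7`, by machine `≅ ℤ/3` iff `g ≡ 1 (mod 3)` for `g ≤ 30` — HOME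
`widen/LIT-W/UTATE-EVERY-G-litw-mukai-g19.md` §2bis, not a theorem of this file). [cite: Mukai1981, Thm. 3.13 (6) and (3.14) (p. 163)] -/
theorem three_smul_mem_coboundary_of_normSum_eq_zero {v : Fin (g + 1) → R} (h : normSum R g v = 0) :
    ∃ w : Fin (g + 1) → R, (-1 : R) ^ g • (fourier R g * twist R g 1) *ᵥ w - w = (3 : R) • v := by
  have hsq : ((-1 : R) ^ g) * ((-1 : R) ^ g) = 1 := by rw [← pow_add, ← two_mul, pow_mul, neg_one_sq, one_pow]
  -- from `N_g v = 0`: `Ψ(Ψ v) = -v - ε Ψ v`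
  have h2 : (fourier R g * twist R g 1) *ᵥ ((fourier R g * twist R g 1) *ᵥ v) =
      -v - (-1 : R) ^ g • (fourier R g * twist R g 1) *ᵥ v := by
    rw [normSum_eq] at h
    rw [eq_sub_iff_add_eq, eq_neg_iff_add_eq_zero, ← h]
    abel
  refine ⟨-((-1 : R) ^ g • (fourier R g * twist R g 1) *ᵥ v + (2 : R) • v), ?_⟩
  rw [Matrix.mulVec_neg, Matrix.mulVec_add, Matrix.mulVec_smul, Matrix.mulVec_smul, h2]
  simp only [smul_add, smul_neg, smul_sub, smul_smul, hsq, one_smul, neg_add_rev]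
  have e3 : (3 : R) • v = v + v + v := by
    rw [show (3 : R) = 1 + 1 + 1 by norm_num, add_smul, add_smul, one_smul]
  have e2 : ((-1 : R) ^ g * 2) • (fourier R g * twist R g 1) *ᵥ v =
      (-1 : R) ^ g • (fourier R g * twist R g 1) *ᵥ v + (-1 : R) ^ g • (fourier R g * twist R g 1) *ᵥ v := by
    rw [mul_two, add_smul]
  have e2' : (2 : R) • v = v + v := by rw [two_smul]
  rw [e3, e2, e2']
  abel

/-! #### End coordinates, every `g` -/

/-- The `e_g`-coordinate of `Ψ^H f`: `(S T f)_g = ε f_0` (row `g` of `S` is `ε e_0`, row `0` of `T` is `e_0`).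
[cite: Mukai1981, Thm. 3.13 (5)–(6) and (3.14) (p. 163)] -/
theorem fourier_mul_twist_mulVec_apply_last (f : Fin (g + 1) → R) :
    ((fourier R g * twist R g 1) *ᵥ f) (Fin.last g) = (-1 : R) ^ g * f 0 := by
  rw [fourier_mul_twist_mulVec_apply, Fin.val_last, Nat.sub_self]
  congr 1
  rw [Finset.sum_eq_single (0 : Fin (g + 1))]
  · rw [Fin.val_zero, Nat.choose_zero_right, Nat.cast_one, one_mul]
  · intro k _ hk
    rw [Nat.choose_eq_zero_of_lt (Nat.pos_of_ne_zero fun e => hk (Fin.ext (by rw [Fin.val_zero]; exact e))),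
      Nat.cast_zero, zero_mul]
  · intro h; exact absurd (Finset.mem_univ _) h

/-- **For a `Ψ^H`-(anti-)fixed class the two end coordinates agree, every `g`**: `S T f = ε f` implies
`f_g = f_0` (the `e_g`-coordinate of `S T f` is `ε f_0`). [cite: Mukai1981, Thm. 3.13 (5)–(6) and (3.14) (p. 163)] -/
theorem apply_last_eq_apply_zero_of_mulVec_eq {f : Fin (g + 1) → R}
    (h : (fourier R g * twist R g 1) *ᵥ f = (-1 : R) ^ g • f) : f (Fin.last g) = f 0 := by
  have hl := congr_fun h (Fin.last g)
  rw [fourier_mul_twist_mulVec_apply_last, Pi.smul_apply, smul_eq_mul] at hl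
  -- hl : ε * f 0 = ε * f last
  have hε : (-1 : R) ^ g * (-1 : R) ^ g = 1 := by rw [← mul_pow, neg_one_mul, neg_neg, one_pow]
  calc f (Fin.last g) = ((-1 : R) ^ g * (-1 : R) ^ g) * f (Fin.last g) := by rw [hε, one_mul]
    _ = (-1 : R) ^ g * ((-1 : R) ^ g * f 0) := by rw [mul_assoc, hl]
    _ = f 0 := by rw [← mul_assoc, hε, one_mul]

/-- For a `Ψ^H`-(anti-)fixed class, `Σ_k C(g,k) f_k = ε f_0` (the `e_0`-coordinate of `S T f = ε f`).
[cite: Mukai1981, Thm. 3.13 (5)–(6) and (3.14) (p. 163)] -/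
theorem sum_choose_mul_apply_eq_of_mulVec_eq {f : Fin (g + 1) → R}
    (h : (fourier R g * twist R g 1) *ᵥ f = (-1 : R) ^ g • f) :
    ∑ k : Fin (g + 1), ((g.choose k : ℕ) : R) * f k = (-1 : R) ^ g * f 0 := by
  have h0 := congr_fun h 0
  rwa [fourier_mul_twist_mulVec_apply_zero, Pi.smul_apply, smul_eq_mul] at h0

/-- **The end-coordinate divisibility of `Ψ^H`-(anti-)fixed classes, every `g ≥ 1`, every commutative ring**: if `d`
divides every inner binomial coefficient `C(g,k)`, `0 < k < g`, then `d ∣ (ε - 2) f_0` for every class `f` with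
`S T f = ε f` — from `Σ_k C(g,k) f_k = ε f_0` and `f_g = f_0`: `Σ_{0<k<g} C(g,k) f_k = (ε - 2) f_0`. For `g` even this is
`d ∣ f_0`, for `g` odd `d ∣ 3 f_0`; over `ℤ` the best `d` is `gcd_{0<k<g} C(g,k) = p` for `g = p^a` a prime power and `1`
otherwise (Ram), whence `natCast_dvd_apply_zero_of_mulVec_eq_pow`. [cite: Mukai1981, Thm. 3.13 (5)–(6) and (3.14) (p. 163)] -/
theorem dvd_mul_apply_zero_of_mulVec_eq (hg : 1 ≤ g) {d : R}
    (hd : ∀ k : ℕ, 0 < k → k < g → d ∣ ((g.choose k : ℕ) : R)) {f : Fin (g + 1) → R}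
    (h : (fourier R g * twist R g 1) *ᵥ f = (-1 : R) ^ g • f) :
    d ∣ ((-1 : R) ^ g - 2) * f 0 := by
  have hsum := sum_choose_mul_apply_eq_of_mulVec_eq g h
  have hlast := apply_last_eq_apply_zero_of_mulVec_eq g h
  have h0l : (0 : Fin (g + 1)) ≠ Fin.last g := by
    intro e; have := congrArg Fin.val e; rw [Fin.val_zero, Fin.val_last] at this; omega
  have hterm : ∀ k : Fin (g + 1), d ∣ ((g.choose k : ℕ) : R) * f k -
      ((if k = 0 then f k else 0) + (if k = Fin.last g then f k else 0)) := by
    intro k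
    by_cases hk0 : k = 0
    · subst hk0
      rw [if_pos rfl, if_neg h0l, Fin.val_zero, Nat.choose_zero_right, Nat.cast_one, one_mul, add_zero, sub_self]
      exact dvd_zero _
    by_cases hkl : k = Fin.last g
    · subst hkl
      rw [if_neg h0l.symm, if_pos rfl, Fin.val_last, Nat.choose_self, Nat.cast_one, one_mul, zero_add, sub_self]
      exact dvd_zero _
    · rw [if_neg hk0, if_neg hkl, add_zero, sub_zero]
      refine Dvd.dvd.mul_right (hd k ?_ ?_) _
      · exact Nat.pos_of_ne_zero fun e => hk0 (Fin.ext (by rw [Fin.val_zero]; exact e))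
      · exact lt_of_le_of_ne (Nat.le_of_lt_succ k.isLt) fun e => hkl (Fin.ext (by rw [Fin.val_last]; exact e))
  have hs := Finset.dvd_sum fun k (_ : k ∈ (Finset.univ : Finset (Fin (g + 1)))) => hterm k
  rw [Finset.sum_sub_distrib, Finset.sum_add_distrib, Finset.sum_ite_eq' Finset.univ (0 : Fin (g + 1)),
    Finset.sum_ite_eq' Finset.univ (Fin.last g), if_pos (Finset.mem_univ _), if_pos (Finset.mem_univ _),
    hsum, hlast] at hs
  have e : ((-1 : R) ^ g - 2) * f 0 = (-1 : R) ^ g * f 0 - (f 0 + f 0) := by ring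
  rwa [e]

/-- **For a prime power `g = p^a` (`p ≠ 3` prime), both end coordinates of every integral
`Ψ^H`-(anti-)fixed theta-power class are divisible by `p`**: `p ∣ C(p^a, k)` for `0 < k < p^a`, so
`p ∣ (ε - 2) f_0` with `ε - 2 = -1` (`p = 2`) or `-3` (`p` odd, `≠ 3`), and `f_g = f_0`. This extends
`natCast_dvd_apply_zero_of_mulVec_eq` (`g = p ≥ 5`) to prime powers and to `p = 2` (`g = 2, 4, 8, 16, …`: `f_0` even); at
the powers of `3` it fails (`g = 3`: `(1,0,-1,1)` is anti-fixed, `fourier_mul_twist_mulVec_eq_neg_iff_three`; `g = 9`: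
`b₁ = (1,0,6,0,-14,23,-19,7,-1,1)` is anti-fixed, `fourier_mul_twist_mulVec_eq_neg_iff_nine`); `a = 0` (`g = 1`,
`Fix^ℤ₁ = 0`) is allowed. [cite: Mukai1981, Thm. 3.13 (5)–(6) and (3.14) (p. 163)] -/
theorem natCast_dvd_apply_zero_of_mulVec_eq_pow {p a : ℕ} (hp : p.Prime) (h3 : p ≠ 3)
    {f : Fin (p ^ a + 1) → ℤ} (h : (fourier ℤ (p ^ a) * twist ℤ (p ^ a) 1) *ᵥ f = (-1 : ℤ) ^ (p ^ a) • f) :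
    (p : ℤ) ∣ f 0 ∧ (p : ℤ) ∣ f (Fin.last (p ^ a)) := by
  have hg : 1 ≤ p ^ a := Nat.one_le_pow _ _ hp.pos
  have hd : ∀ k : ℕ, 0 < k → k < p ^ a → (p : ℤ) ∣ (((p ^ a).choose k : ℕ) : ℤ) := fun k hk0 hk =>
    Int.natCast_dvd_natCast.mpr (hp.dvd_choose_pow hk0.ne' hk.ne)
  have hmain := dvd_mul_apply_zero_of_mulVec_eq (p ^ a) hg hd h
  have hpZ : Prime (p : ℤ) := Nat.prime_iff_prime_int.mp hp
  have h0 : (p : ℤ) ∣ f 0 := by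
    rcases hpZ.dvd_or_dvd hmain with hd3 | hf
    · exfalso
      rcases Nat.even_or_odd (p ^ a) with he | ho
      · rw [he.neg_one_pow, show (1 : ℤ) - 2 = -1 by norm_num, dvd_neg] at hd3
        exact hpZ.not_dvd_one hd3
      · rw [ho.neg_one_pow, show (-1 : ℤ) - 2 = -3 by norm_num, dvd_neg] at hd3
        have : p ∣ 3 := by exact_mod_cast hd3
        exact h3 ((Nat.prime_dvd_prime_iff_eq hp Nat.prime_three).mp this)
    · exact hf
  exact ⟨h0, by rwa [apply_last_eq_apply_zero_of_mulVec_eq _ h]⟩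

/-- **The odd case read on norms, every odd `g`**: if `d ∣ C(g,k)` for `0 < k < g` then `d ∣ (N_g u)_0` for EVERY
class `u` (`(N_g u)_0 = u_0 - Σ_k C(g,k) u_k + u_g`, `normSum_apply_zero`); so for `g = p^a` an odd prime power the
`e_0`-coordinate functional mod `p` kills the whole norm lattice `N_g(R^{g+1})` — at `p = 3` included, where it does
NOT kill the (anti-)fixed lattice (`g = 3, 9`): the `ℤ/3 = Fix^ℤ_g / N_g(ℤ^{g+1})` of
`fourier_mul_twist_mulVec_eq_neg_iff_three` ∕ `exists_normSum_eq_iff_three_dvd_nine` seen through `f ↦ f_0 mod 3`.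
[cite: Mukai1981, Thm. 3.13 (6) and (3.14) (p. 163)] -/
theorem dvd_normSum_apply_zero_of_odd (hg : Odd g) {d : R}
    (hd : ∀ k : ℕ, 0 < k → k < g → d ∣ ((g.choose k : ℕ) : R)) (u : Fin (g + 1) → R) :
    d ∣ normSum R g u 0 := by
  have h0l : (0 : Fin (g + 1)) ≠ Fin.last g := by
    intro e; have := congrArg Fin.val e; rw [Fin.val_zero, Fin.val_last] at this
    exact Nat.ne_of_lt hg.pos this
  have hterm : ∀ k : Fin (g + 1), d ∣ ((g.choose k : ℕ) : R) * u k -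
      ((if k = 0 then u k else 0) + (if k = Fin.last g then u k else 0)) := by
    intro k
    by_cases hk0 : k = 0
    · subst hk0
      rw [if_pos rfl, if_neg h0l, Fin.val_zero, Nat.choose_zero_right, Nat.cast_one, one_mul, add_zero, sub_self]
      exact dvd_zero _
    by_cases hkl : k = Fin.last g
    · subst hkl
      rw [if_neg h0l.symm, if_pos rfl, Fin.val_last, Nat.choose_self, Nat.cast_one, one_mul, zero_add, sub_self]
      exact dvd_zero _
    · rw [if_neg hk0, if_neg hkl, add_zero, sub_zero]
      refine Dvd.dvd.mul_right (hd k ?_ ?_) _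
      · exact Nat.pos_of_ne_zero fun e => hk0 (Fin.ext (by rw [Fin.val_zero]; exact e))
      · exact lt_of_le_of_ne (Nat.le_of_lt_succ k.isLt) fun e => hkl (Fin.ext (by rw [Fin.val_last]; exact e))
  have hs := Finset.dvd_sum fun k (_ : k ∈ (Finset.univ : Finset (Fin (g + 1)))) => hterm k
  rw [Finset.sum_sub_distrib, Finset.sum_add_distrib, Finset.sum_ite_eq' Finset.univ (0 : Fin (g + 1)),
    Finset.sum_ite_eq' Finset.univ (Fin.last g), if_pos (Finset.mem_univ _), if_pos (Finset.mem_univ _)] at hs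
  rw [normSum_apply_zero, hg.neg_one_pow]
  have e : u 0 + -1 * ∑ k : Fin (g + 1), ((g.choose k : ℕ) : R) * u k + u (Fin.last g) =
      -(∑ k : Fin (g + 1), ((g.choose k : ℕ) : R) * u k - (u 0 + u (Fin.last g))) := by ring
  rw [e]
  exact hs.neg_right

/-! #### `g = 6` -/

/-- `Ψ^H = S T` at `g = 6` on a class `f = (f₀, …, f₆)` (coordinates `θ^j/j!`), written out.
[cite: Mukai1981, Thm. 3.13 (5)–(6) and (3.14) (p. 163)] -/
theorem fourier_mul_twist_mulVec_six (f : Fin 7 → R) :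
    (fourier R 6 * twist R 6 1) *ᵥ f =
      ![f 0 + 6 * f 1 + 15 * f 2 + 20 * f 3 + 15 * f 4 + 6 * f 5 + f 6,
        -(f 0 + 5 * f 1 + 10 * f 2 + 10 * f 3 + 5 * f 4 + f 5),
        f 0 + 4 * f 1 + 6 * f 2 + 4 * f 3 + f 4,
        -(f 0 + 3 * f 1 + 3 * f 2 + f 3),
        f 0 + 2 * f 1 + f 2,
        -(f 0 + f 1),
        f 0] := by
  ext m
  rw [fourier_mul_twist_mulVec_apply]
  fin_cases m <;> simp [Fin.sum_univ_succ, Nat.choose] <;> ring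

/-- The norm `N₆ f = f + Ψ f + Ψ² f` at `g = 6`, written out; e.g. `N₆(e₀) = (2,-1,1,-1,1,-1,2)`,
`N₆(2,2,-1,0,0,0,0) = (1,0,3,-5,4,-1,1)`. [cite: Mukai1981, Thm. 3.13 (6) and (3.14) (p. 163)] -/
theorem normSum_six (f : Fin 7 → R) :
    normSum R 6 f =
      ![2 * f 0 + 6 * f 1 + 15 * f 2 + 20 * f 3 + 15 * f 4 + 6 * f 5 + 2 * f 6,
        -(f 0 + 4 * f 1 + 10 * f 2 + 10 * f 3 + 5 * f 4 + 2 * f 5 + f 6),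
        f 0 + 4 * f 1 + 7 * f 2 + 4 * f 3 + 2 * f 4 + 2 * f 5 + f 6,
        -(f 0 + 3 * f 1 + 3 * f 2 + f 3 + 3 * f 4 + 3 * f 5 + f 6),
        f 0 + 2 * f 1 + 2 * f 2 + 4 * f 3 + 7 * f 4 + 4 * f 5 + f 6,
        -(f 0 + 2 * f 1 + 5 * f 2 + 10 * f 3 + 10 * f 4 + 4 * f 5 + f 6),
        2 * f 0 + 6 * f 1 + 15 * f 2 + 20 * f 3 + 15 * f 4 + 6 * f 5 + 2 * f 6] := by
  have hf : f = ![f 0, f 1, f 2, f 3, f 4, f 5, f 6] := by ext m; fin_cases m <;> rfl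
  rw [normSum_eq, fourier_mul_twist_mulVec_six, fourier_mul_twist_mulVec_six]
  conv_lhs => rw [hf]
  ext m; fin_cases m <;> simp <;> ring

/-- **The integral `Ψ^H`-fixed lattice at `g = 6`, written out**: an INTEGER class `f ∈ ℤ^7` (coordinates `θ^j/j!`)
satisfies `S T f = f` iff `f = a b₁ + b b₂ + c b₃` with integers `a, b, c`, where `b₁ = (1,0,1,-2,2,-1,1)`,
`b₂ = (0,1,1,-3,3,-1,0)`, `b₃ = (0,0,2,-3,2,0,0)` (row-Hermite basis, pivots `1, 1, 2`: `a = f₀`, `b = f₁`,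
`c = (f₂ - f₀ - f₁)/2`, the fixed equations forcing `2 f₃ = -f₀ - 3f₁ - 3f₂`, i.e. `f₂ ≡ f₀ + f₁ (mod 2)`). The rational
span is `mem_eigenClasses_six_iff`; this is its integral refinement `Fix^ℤ₆ := ker_ℤ(S T - 1) = ℤ b₁ ⊕ ℤ b₂ ⊕ ℤ b₃`.
Lattice arithmetic in the theta-power model only. [cite: Mukai1981, Thm. 3.13 (6) and (3.14) (p. 163)] -/
theorem fourier_mul_twist_mulVec_eq_self_iff_six (f : Fin 7 → ℤ) :
    (fourier ℤ 6 * twist ℤ 6 1) *ᵥ f = f ↔ ∃ a b c : ℤ,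
      a • (![1, 0, 1, -2, 2, -1, 1] : Fin 7 → ℤ) + b • ![0, 1, 1, -3, 3, -1, 0] + c • ![0, 0, 2, -3, 2, 0, 0] = f := by
  rw [fourier_mul_twist_mulVec_six]
  constructor
  · intro h
    have h0 := congr_fun h 0
    have h1 := congr_fun h 1
    have h2 := congr_fun h 2
    have h3 := congr_fun h 3
    have h4 := congr_fun h 4
    have h5 := congr_fun h 5
    have h6 := congr_fun h 6
    simp at h0 h1 h2 h3 h4 h5 h6
    refine ⟨f 0, f 1, (f 2 - f 0 - f 1) / 2, ?_⟩
    ext m; fin_cases m <;> simp <;> omega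
  · rintro ⟨a, b, c, rfl⟩
    ext m; fin_cases m <;> simp <;> ring

/-- The same lattice in the basis adapted to the norm sublattice: `S T f = f` iff `f = a n₁ + b n₂ + c b₃` with
`n₁ = (1,0,3,-5,4,-1,1) = b₁ + b₃`, `n₂ = (0,1,5,-9,7,-1,0) = b₂ + 2 b₃`, `b₃ = (0,0,2,-3,2,0,0)` (`a = f₀`, `b = f₁`,
`c = (f₂ - 3f₀ - 5f₁)/2`). [cite: Mukai1981, Thm. 3.13 (6) and (3.14) (p. 163)] -/
theorem fourier_mul_twist_mulVec_eq_self_iff_six' (f : Fin 7 → ℤ) :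
    (fourier ℤ 6 * twist ℤ 6 1) *ᵥ f = f ↔ ∃ a b c : ℤ,
      a • (![1, 0, 3, -5, 4, -1, 1] : Fin 7 → ℤ) + b • ![0, 1, 5, -9, 7, -1, 0] + c • ![0, 0, 2, -3, 2, 0, 0] = f := by
  rw [fourier_mul_twist_mulVec_eq_self_iff_six]
  constructor
  · rintro ⟨a, b, c, rfl⟩
    refine ⟨a, b, c - a - 2 * b, ?_⟩
    ext m; fin_cases m <;> simp <;> ring
  · rintro ⟨a, b, c, rfl⟩
    refine ⟨a, b, c + a + 2 * b, ?_⟩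
    ext m; fin_cases m <;> simp <;> ring

/-- **The norm sublattice at `g = 6`, written out**: `N₆(ℤ^7) = ℤ n₁ ⊕ ℤ n₂ ⊕ ℤ n₃` with `n₁ = (1,0,3,-5,4,-1,1) =
N₆(2,2,-1,0,0,0,0)`, `n₂ = (0,1,5,-9,7,-1,0) = N₆(3,4,-2,0,0,0,0)`, `n₃ = (0,0,6,-9,6,0,0) = N₆(0,5,-2,0,0,0,0) = 3 b₃`
(row-Hermite basis, pivots `1, 1, 6`; the congruence `(N₆u)₂ - 3(N₆u)₀ - 5(N₆u)₁ = 6(u₁ + 2u₂ - u₃ - 3u₄ - u₅)`).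
With `fourier_mul_twist_mulVec_eq_self_iff_six'` (`Fix^ℤ₆ = ℤ n₁ ⊕ ℤ n₂ ⊕ ℤ b₃`): elementary divisors `(1, 1, 3)`,
**`Fix^ℤ₆ / N₆(ℤ^7) ≅ ℤ/3`**. [cite: Mukai1981, Thm. 3.13 (6) and (3.14) (p. 163)] -/
theorem exists_normSum_eq_iff_six (f : Fin 7 → ℤ) :
    (∃ u : Fin 7 → ℤ, normSum ℤ 6 u = f) ↔ ∃ a b c : ℤ,
      a • (![1, 0, 3, -5, 4, -1, 1] : Fin 7 → ℤ) + b • ![0, 1, 5, -9, 7, -1, 0] + c • ![0, 0, 6, -9, 6, 0, 0] = f := by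
  constructor
  · rintro ⟨u, h⟩
    rw [normSum_six] at h
    have h0 := congr_fun h 0
    have h1 := congr_fun h 1
    have h2 := congr_fun h 2
    have h3 := congr_fun h 3
    have h4 := congr_fun h 4
    have h5 := congr_fun h 5
    have h6 := congr_fun h 6
    simp at h0 h1 h2 h3 h4 h5 h6
    refine ⟨f 0, f 1, (f 2 - 3 * f 0 - 5 * f 1) / 6, ?_⟩
    ext m; fin_cases m <;> simp <;> omega
  · rintro ⟨a, b, c, rfl⟩
    refine ⟨![2 * a + 3 * b, 2 * a + 4 * b + 5 * c, -(a + 2 * b + 2 * c), 0, 0, 0, 0], ?_⟩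
    rw [normSum_six]
    ext m; fin_cases m <;> simp <;> ring

/-- **The quotient `Fix^ℤ₆ / N₆(ℤ^7) ≅ ℤ/3` is generated by the class of `v₂ = (2,-1,-1,2,-1,-1,2)`** (`= 2n₁ - n₂ - b₃`):
every integral `Ψ^H`-fixed class `f` at `g = 6` is a norm, or `f + v₂` is, or `f - v₂` is; and `v₂` itself is NOT a norm
(`not_exists_normSum_eq_six`), while `3 v₂ = N₆(3,-5,2,0,0,0,0)`, `t = (0,1,-1,0,1,-1,0) = N₆(3,-1,0,0,0,0,0)` and
`N₆(e₀) = (2,-1,1,-1,1,-1,2) = 2b₁ - b₂` are norms (`normSum_six_examples`). So among the integral classes of the plane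
`⟨v₂, t⟩ = Fix(Ψ^H) ∩ ker λ` of `mem_eigenClasses_six_and_trinomialRow_dotProduct_eq_zero_iff`, `t ∈ N₆(ℤ^7)` and
`v₂ ∉ N₆(ℤ^7)`. Lattice arithmetic only; the numbers were recorded ×2 across codes in HOME `widen/W5` / `s4push/search-3`
(row U-TATE). [cite: Mukai1981, Thm. 3.13 (6) and (3.14) (p. 163)] -/
theorem exists_normSum_eq_or_six (f : Fin 7 → ℤ) (hf : (fourier ℤ 6 * twist ℤ 6 1) *ᵥ f = f) :
    (∃ u : Fin 7 → ℤ, normSum ℤ 6 u = f) ∨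
      (∃ u : Fin 7 → ℤ, normSum ℤ 6 u = f + ![2, -1, -1, 2, -1, -1, 2]) ∨
      (∃ u : Fin 7 → ℤ, normSum ℤ 6 u = f - ![2, -1, -1, 2, -1, -1, 2]) := by
  obtain ⟨a, b, c, rfl⟩ := (fourier_mul_twist_mulVec_eq_self_iff_six' f).mp hf
  simp only [exists_normSum_eq_iff_six]
  rcases (by omega : c % 3 = 0 ∨ c % 3 = 1 ∨ c % 3 = 2) with hc | hc | hc
  · refine Or.inl ⟨a, b, c / 3, ?_⟩
    ext m; fin_cases m <;> simp <;> omega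
  · refine Or.inr (Or.inl ⟨a + 2, b - 1, (c - 1) / 3, ?_⟩)
    ext m; fin_cases m <;> simp <;> omega
  · refine Or.inr (Or.inr ⟨a - 2, b + 1, (c + 1) / 3, ?_⟩)
    ext m; fin_cases m <;> simp <;> omega

/-- `v₂ = (2,-1,-1,2,-1,-1,2)` and `w = (20,-10,8,-7,8,-10,20)` (`= 20 f^λ`, `twenty_smul_trinomialDual_three`) are
`Ψ^H`-fixed (`euler_six_fixedBasis`) but NOT norms: `v₂, w ∉ N₆(ℤ^7)`. [cite: Mukai1981, Thm. 3.13 (6) and (3.14) (p. 163)] -/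
theorem not_exists_normSum_eq_six :
    (¬ ∃ u : Fin 7 → ℤ, normSum ℤ 6 u = ![2, -1, -1, 2, -1, -1, 2]) ∧
      ¬ ∃ u : Fin 7 → ℤ, normSum ℤ 6 u = ![20, -10, 8, -7, 8, -10, 20] := by
  constructor
  all_goals
    rw [exists_normSum_eq_iff_six]
    rintro ⟨a, b, c, h⟩
    have h0 := congr_fun h 0
    have h1 := congr_fun h 1
    have h2 := congr_fun h 2
    simp at h0 h1 h2
    omega

/-- Norms at `g = 6`, written out: `N₆(e₀) = (2,-1,1,-1,1,-1,2)` (`= 2b₁ - b₂`), `N₆(3e₀ - e₁) = t = (0,1,-1,0,1,-1,0)`,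
`N₆(3,-5,2,0,0,0,0) = 3 v₂ = (6,-3,-3,6,-3,-3,6)`, and the basis preimages `N₆(2,2,-1,0,…) = n₁`, `N₆(3,4,-2,0,…) = n₂`,
`N₆(0,5,-2,0,…) = n₃`. [cite: Mukai1981, Thm. 3.13 (6) and (3.14) (p. 163)] -/
theorem normSum_six_examples :
    normSum ℤ 6 ![1, 0, 0, 0, 0, 0, 0] = ![2, -1, 1, -1, 1, -1, 2] ∧
    normSum ℤ 6 ![3, -1, 0, 0, 0, 0, 0] = ![0, 1, -1, 0, 1, -1, 0] ∧
    normSum ℤ 6 ![3, -5, 2, 0, 0, 0, 0] = ![6, -3, -3, 6, -3, -3, 6] ∧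
    normSum ℤ 6 ![2, 2, -1, 0, 0, 0, 0] = ![1, 0, 3, -5, 4, -1, 1] ∧
    normSum ℤ 6 ![3, 4, -2, 0, 0, 0, 0] = ![0, 1, 5, -9, 7, -1, 0] ∧
    normSum ℤ 6 ![0, 5, -2, 0, 0, 0, 0] = ![0, 0, 6, -9, 6, 0, 0] := by
  refine ⟨?_, ?_, ?_, ?_, ?_, ?_⟩ <;> (rw [normSum_six]; ext m; fin_cases m <;> simp)

/-- A fixed class at `g = 6` has `3 f ∈ N₆(ℤ^7)` (the quotient `Fix^ℤ₆ / N₆(ℤ^7)` is `3`-torsion — in fact `ℤ/3`,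
`exists_normSum_eq_or_six`). [cite: Mukai1981, Thm. 3.13 (6) and (3.14) (p. 163)] -/
theorem exists_normSum_eq_three_smul_six (f : Fin 7 → ℤ) (hf : (fourier ℤ 6 * twist ℤ 6 1) *ᵥ f = f) :
    ∃ u : Fin 7 → ℤ, normSum ℤ 6 u = 3 • f := by
  obtain ⟨a, b, c, rfl⟩ := (fourier_mul_twist_mulVec_eq_self_iff_six' f).mp hf
  rw [exists_normSum_eq_iff_six]
  refine ⟨3 * a, 3 * b, c, ?_⟩
  ext m; fin_cases m <;> simp <;> ring

/-- **The Euler form on the integral fixed lattice `Fix^ℤ₆`**, written out on the basis `b₁ = (1,0,1,-2,2,-1,1)`,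
`b₂ = (0,1,1,-3,3,-1,0)`, `b₃ = (0,0,2,-3,2,0,0)`: `χ`-Gram `[[-18,-39,-30],[-39,-78,-60],[-30,-60,-60]]` (its
determinant is `1620 = 2²·3⁴·5` — hand arithmetic, not a kernel statement here; the classes `v₂, t, w` of
`euler_six_fixedBasis`, Gram `diag(-54,-18,540)` of determinant `1620 · 18²`, span a sublattice of index `18`). Pure arithmetic of `χ(v, w) = Σ_j (-1)^j C(6, j) v_j w_{6-j}`.
[cite: Mukai1987FourierFunctor, (1.19)–(1.20) (p. 527)] -/
theorem euler_six_intBasis :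
    euler ℤ 6 ![1, 0, 1, -2, 2, -1, 1] ![1, 0, 1, -2, 2, -1, 1] = -18 ∧
    euler ℤ 6 ![1, 0, 1, -2, 2, -1, 1] ![0, 1, 1, -3, 3, -1, 0] = -39 ∧
    euler ℤ 6 ![1, 0, 1, -2, 2, -1, 1] ![0, 0, 2, -3, 2, 0, 0] = -30 ∧
    euler ℤ 6 ![0, 1, 1, -3, 3, -1, 0] ![0, 1, 1, -3, 3, -1, 0] = -78 ∧
    euler ℤ 6 ![0, 1, 1, -3, 3, -1, 0] ![0, 0, 2, -3, 2, 0, 0] = -60 ∧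
    euler ℤ 6 ![0, 0, 2, -3, 2, 0, 0] ![0, 0, 2, -3, 2, 0, 0] = -60 := by
  refine ⟨?_, ?_, ?_, ?_, ?_, ?_⟩ <;> norm_num [euler, Fin.sum_univ_succ, Fin.rev, Nat.choose]

/-! #### `g = 4` -/

/-- `Ψ^H = S T` at `g = 4` on `f = (f₀, …, f₄)`, written out (`S` at `g = 4` is the `Φ v = (v₄, -v₃, v₂, -v₁, v₀)` of the
tree's `HodgeTheory/SemiregularityEulerFormBarrier.lean`, so this is its `Φ ∘ T`). [cite: Mukai1981, Thm. 3.13 (5)–(6) and (3.14) (p. 163)] -/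
theorem fourier_mul_twist_mulVec_four (f : Fin 5 → R) :
    (fourier R 4 * twist R 4 1) *ᵥ f =
      ![f 0 + 4 * f 1 + 6 * f 2 + 4 * f 3 + f 4, -(f 0 + 3 * f 1 + 3 * f 2 + f 3), f 0 + 2 * f 1 + f 2,
        -(f 0 + f 1), f 0] := by
  ext m
  rw [fourier_mul_twist_mulVec_apply]
  fin_cases m <;> simp [Fin.sum_univ_succ, Nat.choose] <;> ring

/-- The norm at `g = 4`, written out: `N₄ f = (f₀ + 2f₁ + 3f₂ + 2f₃ + f₄) · (2,-1,1,-1,2)` — `N₄` has RANK ONE, its image is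
the line through `N₄(e₀) = (2,-1,1,-1,2) = e₀ + e^{-θ} + pt`, and the coefficient is `χ`-dual to… the trinomial row
`(1,2,3,2,1)` of `mem_eigenClasses_four_iff`. [cite: Mukai1981, Thm. 3.13 (6) and (3.14) (p. 163)] -/
theorem normSum_four (f : Fin 5 → R) :
    normSum R 4 f = (f 0 + 2 * f 1 + 3 * f 2 + 2 * f 3 + f 4) • ![2, -1, 1, -1, 2] := by
  have hf : f = ![f 0, f 1, f 2, f 3, f 4] := by ext m; fin_cases m <;> rfl
  rw [normSum_eq, fourier_mul_twist_mulVec_four, fourier_mul_twist_mulVec_four]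
  conv_lhs => rw [hf]
  ext m; fin_cases m <;> simp <;> ring

/-- **At `g = 4` every integral `Ψ^H`-fixed class is a norm**: `S T f = f` iff `f ∈ ℤ · (2,-1,1,-1,2)` iff `f ∈ N₄(ℤ^5)`
(`Fix^ℤ₄ = N₄(ℤ^5) = ℤ · N₄(e₀)`, index `1`; rational version `mem_eigenClasses_four_iff`).
[cite: Mukai1981, Thm. 3.13 (6) and (3.14) (p. 163)] -/
theorem fourier_mul_twist_mulVec_eq_self_iff_four (f : Fin 5 → ℤ) :
    ((fourier ℤ 4 * twist ℤ 4 1) *ᵥ f = f ↔ ∃ a : ℤ, a • (![2, -1, 1, -1, 2] : Fin 5 → ℤ) = f) ∧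
    ((∃ u : Fin 5 → ℤ, normSum ℤ 4 u = f) ↔ ∃ a : ℤ, a • (![2, -1, 1, -1, 2] : Fin 5 → ℤ) = f) := by
  constructor
  · rw [fourier_mul_twist_mulVec_four]
    constructor
    · intro h
      have h0 := congr_fun h 0
      have h1 := congr_fun h 1
      have h2 := congr_fun h 2
      have h3 := congr_fun h 3
      have h4 := congr_fun h 4
      simp at h0 h1 h2 h3 h4
      refine ⟨-f 1, ?_⟩
      ext m; fin_cases m <;> simp <;> omega
    · rintro ⟨a, rfl⟩
      ext m; fin_cases m <;> simp <;> ring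
  · constructor
    · rintro ⟨u, rfl⟩
      exact ⟨_, (normSum_four u).symm⟩
    · rintro ⟨a, rfl⟩
      refine ⟨![a, 0, 0, 0, 0], ?_⟩
      rw [normSum_four]
      ext m; fin_cases m <;> simp

/-- **The twin law at `g = 4`, kernel instance (Tate `Ĥ⁻¹` of the order-`3` element `Ψ^H = S T` on `ℤ^5`)**: the
integral class `u = (-1,-1,0,1,1) = (e₃ + e₄) - (e₀ + e₁)` has norm zero, `N₄ u = 0`, but is NOT a `Ψ^H`-coboundary —
there is no `v ∈ ℤ^5` with `S T v - v = u` (the obstruction is mod `3`: `f ↦ f₀ + f₁ + f₄` kills `(S T - 1) ℤ^5` modulo `3`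
and takes the value `-1` on `u`) — while `3 u = S T v - v` for `v = (0,0,2,-3,-3)`. So `ker N₄ / (S T - 1) ℤ^5 ≠ 0`
(by machine `≅ ℤ/3`; at `g = 3, 5, 6` it vanishes); over `ℚ` the class `u` IS a coboundary. Arithmetic of the
`5`-dimensional theta-power model only. [cite: Mukai1981, Thm. 3.13 (6) and (3.14) (p. 163)] -/
theorem normSum_eq_zero_not_coboundary_four :
    normSum ℤ 4 ![-1, -1, 0, 1, 1] = 0 ∧
    (¬ ∃ v : Fin 5 → ℤ, (fourier ℤ 4 * twist ℤ 4 1) *ᵥ v - v = ![-1, -1, 0, 1, 1]) ∧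
    (fourier ℤ 4 * twist ℤ 4 1) *ᵥ ![0, 0, 2, -3, -3] - ![0, 0, 2, -3, -3] = 3 • ![-1, -1, 0, 1, 1] := by
  refine ⟨?_, ?_, ?_⟩
  · rw [normSum_four]
    ext m; fin_cases m <;> simp
  · rintro ⟨v, hv⟩
    rw [fourier_mul_twist_mulVec_four] at hv
    have h2 := congr_fun hv 2
    have h3 := congr_fun hv 3
    have h4 := congr_fun hv 4
    have h1 := congr_fun hv 1
    simp at h1 h2 h3 h4
    omega
  · rw [fourier_mul_twist_mulVec_four]
    ext m; fin_cases m <;> simp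

/-! #### `g = 3` -/

/-- `Ψ^H = S T` at `g = 3` on `f = (f₀, …, f₃)`, written out. [cite: Mukai1981, Thm. 3.13 (5)–(6) and (3.14) (p. 163)] -/
theorem fourier_mul_twist_mulVec_three (f : Fin 4 → R) :
    (fourier R 3 * twist R 3 1) *ᵥ f =
      ![f 0 + 3 * f 1 + 3 * f 2 + f 3, -(f 0 + 2 * f 1 + f 2), f 0 + f 1, -f 0] := by
  ext m
  rw [fourier_mul_twist_mulVec_apply]
  fin_cases m <;> simp [Fin.sum_univ_succ, Nat.choose] <;> ring

/-- The norm `N₃ f = f - Ψ f + Ψ² f` at `g = 3` (`ε = -1`), written out; `N₃(e₀) = (0,1,-1,0) = t₀`,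
`N₃(-e^θ) = -N₃(1,1,1,1) = (6,-3,-3,6) = 3 v₂`. [cite: Mukai1981, Thm. 3.13 (6) and (3.14) (p. 163)] -/
theorem normSum_three (f : Fin 4 → R) :
    normSum R 3 f =
      ![-(3 * f 1 + 3 * f 2), f 0 + 3 * f 1 - f 3, -f 0 + 3 * f 2 + f 3, -(3 * f 1 + 3 * f 2)] := by
  have hf : f = ![f 0, f 1, f 2, f 3] := by ext m; fin_cases m <;> rfl
  rw [normSum_eq, fourier_mul_twist_mulVec_three, fourier_mul_twist_mulVec_three]
  conv_lhs => rw [hf]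
  ext m; fin_cases m <;> simp <;> ring

/-- **The integral ANTI-fixed lattice and the norm sublattice at `g = 3`, written out**: `S T f = -f` iff
`f = a (1,0,-1,1) + b (0,1,-1,0)` with integers `a = f₀`, `b = f₁` (`Fix^ℤ₃ := ker_ℤ(S T + 1)`, free of rank `2`, all of
`{(f₀, f₁, -f₀-f₁, f₀)}`; rational version `mem_eigenClasses_three_iff`), and `f ∈ N₃(ℤ^4)` iff
`f = a (3,0,-3,3) + b (0,1,-1,0)` (elementary divisors `(1, 3)`: **`Fix^ℤ₃ / N₃(ℤ^4) ≅ ℤ/3`**, generated by the class of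
`(1,0,-1,1)`, equivalently of `v₂ = (2,-1,-1,2) = 2(1,0,-1,1) - t₀`). [cite: Mukai1981, Thm. 3.13 (6) and (3.14) (p. 163)] -/
theorem fourier_mul_twist_mulVec_eq_neg_iff_three (f : Fin 4 → ℤ) :
    ((fourier ℤ 3 * twist ℤ 3 1) *ᵥ f = -f ↔
      ∃ a b : ℤ, a • (![1, 0, -1, 1] : Fin 4 → ℤ) + b • ![0, 1, -1, 0] = f) ∧
    ((∃ u : Fin 4 → ℤ, normSum ℤ 3 u = f) ↔
      ∃ a b : ℤ, a • (![3, 0, -3, 3] : Fin 4 → ℤ) + b • ![0, 1, -1, 0] = f) := by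
  constructor
  · rw [fourier_mul_twist_mulVec_three]
    constructor
    · intro h
      have h0 := congr_fun h 0
      have h1 := congr_fun h 1
      have h2 := congr_fun h 2
      have h3 := congr_fun h 3
      simp at h0 h1 h2 h3
      refine ⟨f 0, f 1, ?_⟩
      ext m; fin_cases m <;> simp <;> omega
    · rintro ⟨a, b, rfl⟩
      ext m; fin_cases m <;> simp <;> ring
  · constructor
    · rintro ⟨u, h⟩
      rw [normSum_three] at h
      have h0 := congr_fun h 0
      have h1 := congr_fun h 1
      have h2 := congr_fun h 2
      have h3 := congr_fun h 3
      simp at h0 h1 h2 h3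
      refine ⟨-(u 1 + u 2), u 0 + 3 * u 1 - u 3, ?_⟩
      ext m; fin_cases m <;> simp <;> omega
    · rintro ⟨a, b, rfl⟩
      refine ⟨![b + 3 * a, -a, 0, 0], ?_⟩
      rw [normSum_three]
      ext m; fin_cases m <;> simp <;> ring

/-- At `g = 3`: `v₂ = (2,-1,-1,2)` is anti-fixed but NOT a norm, while `t₀ = (0,1,-1,0) = N₃(e₀)` and
`3 v₂ = (6,-3,-3,6) = N₃(-1,-1,-1,-1)` are norms. [cite: Mukai1981, Thm. 3.13 (6) and (3.14) (p. 163)] -/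
theorem normSum_three_examples :
    (¬ ∃ u : Fin 4 → ℤ, normSum ℤ 3 u = ![2, -1, -1, 2]) ∧
      normSum ℤ 3 ![1, 0, 0, 0] = ![0, 1, -1, 0] ∧ normSum ℤ 3 ![-1, -1, -1, -1] = ![6, -3, -3, 6] := by
  refine ⟨?_, ?_, ?_⟩
  · rw [(fourier_mul_twist_mulVec_eq_neg_iff_three _).2]
    rintro ⟨a, b, h⟩
    have h0 := congr_fun h 0
    simp at h0
    omega
  · rw [normSum_three]; ext m; fin_cases m <;> simp
  · rw [normSum_three]; ext m; fin_cases m <;> simp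

/-- The Euler form (skew at odd `g`) on the integral anti-fixed lattice `Fix^ℤ₃ = ℤ(1,0,-1,1) ⊕ ℤ(0,1,-1,0)`:
`χ((1,0,-1,1), (0,1,-1,0)) = -3` (Gram `[[0,-3],[3,0]]`; `⟨v₂, t₀⟩` has index `2` in it, `(1,0,-1,1) = (v₂ + t₀)/2`).
[cite: Mukai1987FourierFunctor, (1.19)–(1.20) (p. 527)] -/
theorem euler_three_intBasis :
    euler ℤ 3 ![1, 0, -1, 1] ![0, 1, -1, 0] = -3 ∧ euler ℤ 3 ![0, 1, -1, 0] ![1, 0, -1, 1] = 3 ∧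
    euler ℤ 3 ![1, 0, -1, 1] ![1, 0, -1, 1] = 0 ∧ euler ℤ 3 ![0, 1, -1, 0] ![0, 1, -1, 0] = 0 := by
  refine ⟨?_, ?_, ?_, ?_⟩ <;> norm_num [euler, Fin.sum_univ_succ, Fin.rev, Nat.choose]

/-- **Norms are eigenclasses** (rational form): `N_g v ∈ eigenClasses g` for every `v ∈ ℚ^{g+1}`.
[cite: Mukai1981, Thm. 3.13 (6) and (3.14) (p. 163)] -/
theorem normSum_mem_eigenClasses (v : Fin (g + 1) → ℚ) : normSum ℚ g v ∈ eigenClasses g :=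
  mem_eigenClasses.mpr (fourier_mul_twist_mulVec_normSum g v)

/-! #### `g = 5` and `g = 7` (odd, `ε = -1`): every integral anti-fixed class is a norm (index `1`) -/

/-- `Ψ^H = S T` at `g = 5`, written out. [cite: Mukai1981, Thm. 3.13 (5)–(6) and (3.14) (p. 163)] -/
theorem fourier_mul_twist_mulVec_five (f : Fin 6 → R) :
    (fourier R 5 * twist R 5 1) *ᵥ f =
      ![f 0 + 5 * f 1 + 10 * f 2 + 10 * f 3 + 5 * f 4 + f 5, -(f 0 + 4 * f 1 + 6 * f 2 + 4 * f 3 + f 4),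
        f 0 + 3 * f 1 + 3 * f 2 + f 3, -(f 0 + 2 * f 1 + f 2), f 0 + f 1, -f 0] := by
  ext m
  rw [fourier_mul_twist_mulVec_apply]
  fin_cases m <;> simp [Fin.sum_univ_succ, Nat.choose] <;> ring

/-- The norm `N₅ f = f - Ψ f + Ψ² f` at `g = 5`, written out (`N₅(e₀) = (0,1,-1,1,-1,0)`).
[cite: Mukai1981, Thm. 3.13 (6) and (3.14) (p. 163)] -/
theorem normSum_five (f : Fin 6 → R) :
    normSum R 5 f =
      ![-(5 * f 1 + 10 * f 2 + 10 * f 3 + 5 * f 4), f 0 + 5 * f 1 + 6 * f 2 + 4 * f 3 - f 5,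
        -(f 0 + 3 * f 1 + 2 * f 2) + 2 * f 4 + f 5, f 0 + 2 * f 1 - 2 * f 3 - 3 * f 4 - f 5,
        -f 0 + 4 * f 2 + 6 * f 3 + 5 * f 4 + f 5, -(5 * f 1 + 10 * f 2 + 10 * f 3 + 5 * f 4)] := by
  have hf : f = ![f 0, f 1, f 2, f 3, f 4, f 5] := by ext m; fin_cases m <;> rfl
  rw [normSum_eq, fourier_mul_twist_mulVec_five, fourier_mul_twist_mulVec_five]
  conv_lhs => rw [hf]
  ext m; fin_cases m <;> simp <;> ring

/-- **`g = 5`: the integral anti-fixed lattice equals the norm lattice** (index `1`, no `ℤ/3`):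
`S T f = -f` iff `f = a (5,0,-2,3,-5,5) + b (0,1,-1,1,-1,0)` (`a = f₀/5`, `b = f₁`; so `f₀ ∈ 5ℤ`) iff `f ∈ N₅(ℤ^6)`
(`N₅(e₀) = (0,1,-1,1,-1,0)`, `N₅(-3,-1,4,-4,0,0) = (5,0,-2,3,-5,5)`). [cite: Mukai1981, Thm. 3.13 (6) and (3.14) (p. 163)] -/
theorem fourier_mul_twist_mulVec_eq_neg_iff_five (f : Fin 6 → ℤ) :
    ((fourier ℤ 5 * twist ℤ 5 1) *ᵥ f = -f ↔
      ∃ a b : ℤ, a • (![5, 0, -2, 3, -5, 5] : Fin 6 → ℤ) + b • ![0, 1, -1, 1, -1, 0] = f) ∧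
    ((∃ u : Fin 6 → ℤ, normSum ℤ 5 u = f) ↔
      ∃ a b : ℤ, a • (![5, 0, -2, 3, -5, 5] : Fin 6 → ℤ) + b • ![0, 1, -1, 1, -1, 0] = f) := by
  constructor
  · rw [fourier_mul_twist_mulVec_five]
    constructor
    · intro h
      have h0 := congr_fun h 0
      have h1 := congr_fun h 1
      have h2 := congr_fun h 2
      have h3 := congr_fun h 3
      have h4 := congr_fun h 4
      have h5 := congr_fun h 5
      simp at h0 h1 h2 h3 h4 h5
      refine ⟨f 0 / 5, f 1, ?_⟩
      ext m; fin_cases m <;> simp <;> omega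
    · rintro ⟨a, b, rfl⟩
      ext m; fin_cases m <;> simp <;> ring
  · constructor
    · rintro ⟨u, h⟩
      rw [normSum_five] at h
      have h0 := congr_fun h 0
      have h1 := congr_fun h 1
      have h2 := congr_fun h 2
      have h3 := congr_fun h 3
      have h4 := congr_fun h 4
      have h5 := congr_fun h 5
      simp at h0 h1 h2 h3 h4 h5
      refine ⟨f 0 / 5, f 1, ?_⟩
      ext m; fin_cases m <;> simp <;> omega
    · rintro ⟨a, b, rfl⟩
      refine ⟨![-(3 * a) + b, -a, 4 * a, -(4 * a), 0, 0], ?_⟩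
      rw [normSum_five]
      ext m; fin_cases m <;> simp <;> ring

/-- `Ψ^H = S T` at `g = 7`, written out. [cite: Mukai1981, Thm. 3.13 (5)–(6) and (3.14) (p. 163)] -/
theorem fourier_mul_twist_mulVec_seven (f : Fin 8 → R) :
    (fourier R 7 * twist R 7 1) *ᵥ f =
      ![f 0 + 7 * f 1 + 21 * f 2 + 35 * f 3 + 35 * f 4 + 21 * f 5 + 7 * f 6 + f 7,
        -(f 0 + 6 * f 1 + 15 * f 2 + 20 * f 3 + 15 * f 4 + 6 * f 5 + f 6),
        f 0 + 5 * f 1 + 10 * f 2 + 10 * f 3 + 5 * f 4 + f 5, -(f 0 + 4 * f 1 + 6 * f 2 + 4 * f 3 + f 4),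
        f 0 + 3 * f 1 + 3 * f 2 + f 3, -(f 0 + 2 * f 1 + f 2), f 0 + f 1, -f 0] := by
  ext m
  rw [fourier_mul_twist_mulVec_apply]
  fin_cases m <;> simp [Fin.sum_univ_succ, Nat.choose] <;> ring

/-- The norm `N₇ f = f - Ψ f + Ψ² f` at `g = 7`, written out (`N₇(e₀) = (0,1,-1,1,-1,1,-1,0)`).
[cite: Mukai1981, Thm. 3.13 (6) and (3.14) (p. 163)] -/
theorem normSum_seven (f : Fin 8 → R) :
    normSum R 7 f =
      ![-(7 * f 1 + 21 * f 2 + 35 * f 3 + 35 * f 4 + 21 * f 5 + 7 * f 6),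
        f 0 + 7 * f 1 + 15 * f 2 + 20 * f 3 + 15 * f 4 + 6 * f 5 - f 7,
        -(f 0 + 5 * f 1 + 9 * f 2 + 10 * f 3 + 5 * f 4) + 2 * f 6 + f 7,
        f 0 + 4 * f 1 + 6 * f 2 + 5 * f 3 - 3 * f 5 - 3 * f 6 - f 7,
        -(f 0 + 3 * f 1 + 3 * f 2) + 5 * f 4 + 6 * f 5 + 4 * f 6 + f 7,
        f 0 + 2 * f 1 - 5 * f 3 - 10 * f 4 - 9 * f 5 - 5 * f 6 - f 7,
        -f 0 + 6 * f 2 + 15 * f 3 + 20 * f 4 + 15 * f 5 + 7 * f 6 + f 7,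
        -(7 * f 1 + 21 * f 2 + 35 * f 3 + 35 * f 4 + 21 * f 5 + 7 * f 6)] := by
  have hf : f = ![f 0, f 1, f 2, f 3, f 4, f 5, f 6, f 7] := by ext m; fin_cases m <;> rfl
  rw [normSum_eq, fourier_mul_twist_mulVec_seven, fourier_mul_twist_mulVec_seven]
  conv_lhs => rw [hf]
  ext m; fin_cases m <;> simp <;> ring

/-- **`g = 7`: the integral anti-fixed lattice equals the norm lattice** (index `1`, no `ℤ/3` — the `n = 7` clause of the
U-TATE law): `S T f = -f` iff `f = a (7,0,-2,3,-4,5,-7,7) + b (0,1,-1,1,-1,1,-1,0)` (`a = f₀/7`, `b = f₁`; so every integral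
anti-fixed class at `g = 7` has `f₀ ∈ 7ℤ`) iff `f ∈ N₇(ℤ^8)` (`N₇(e₀) = (0,1,-1,1,-1,1,-1,0)`, `N₇(-2,1,1,-1,0,0,0,0) =
(7,0,-2,3,-4,5,-7,7)`). [cite: Mukai1981, Thm. 3.13 (6) and (3.14) (p. 163)] -/
theorem fourier_mul_twist_mulVec_eq_neg_iff_seven (f : Fin 8 → ℤ) :
    ((fourier ℤ 7 * twist ℤ 7 1) *ᵥ f = -f ↔
      ∃ a b : ℤ, a • (![7, 0, -2, 3, -4, 5, -7, 7] : Fin 8 → ℤ) + b • ![0, 1, -1, 1, -1, 1, -1, 0] = f) ∧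
    ((∃ u : Fin 8 → ℤ, normSum ℤ 7 u = f) ↔
      ∃ a b : ℤ, a • (![7, 0, -2, 3, -4, 5, -7, 7] : Fin 8 → ℤ) + b • ![0, 1, -1, 1, -1, 1, -1, 0] = f) := by
  constructor
  · rw [fourier_mul_twist_mulVec_seven]
    constructor
    · intro h
      have h0 := congr_fun h 0
      have h1 := congr_fun h 1
      have h2 := congr_fun h 2
      have h3 := congr_fun h 3
      have h4 := congr_fun h 4
      have h5 := congr_fun h 5
      have h6 := congr_fun h 6
      have h7 := congr_fun h 7
      simp at h0 h1 h2 h3 h4 h5 h6 h7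
      refine ⟨f 0 / 7, f 1, ?_⟩
      ext m; fin_cases m <;> simp <;> omega
    · rintro ⟨a, b, rfl⟩
      ext m; fin_cases m <;> simp <;> ring
  · constructor
    · rintro ⟨u, h⟩
      rw [normSum_seven] at h
      have h0 := congr_fun h 0
      have h1 := congr_fun h 1
      have h2 := congr_fun h 2
      have h3 := congr_fun h 3
      have h4 := congr_fun h 4
      have h5 := congr_fun h 5
      have h6 := congr_fun h 6
      have h7 := congr_fun h 7
      simp at h0 h1 h2 h3 h4 h5 h6 h7
      refine ⟨f 0 / 7, f 1, ?_⟩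
      ext m; fin_cases m <;> simp <;> omega
    · rintro ⟨a, b, rfl⟩
      refine ⟨![-(2 * a) + b, a, a, -a, 0, 0, 0, 0], ?_⟩
      rw [normSum_seven]
      ext m; fin_cases m <;> simp <;> ring

/-- **The twin law at `g = 7`, kernel instance (Tate `Ĥ⁻¹` of the order-`3` element `-Ψ^H = -S T` on `ℤ^8`)**: the
integral class `u = (0,2,0,-1,0,1,0,0) = 2e₁ - e₃ + e₅` has norm zero, `N₇ u = u - Ψ u + Ψ² u = 0`, but is NOT a
`Ψ^H`-coboundary — there is no `v ∈ ℤ^8` with `S T v + v = u` (at odd `g` the coboundaries of `⟨-Ψ⟩` are `(-Ψ - 1) ℤ^8 =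
(Ψ + 1) ℤ^8`; the obstruction is mod `3`) — while `3 u = S T v + v` for `v = (0,3,-2,3,-6,7,-3,0)`. So
`ker N₇ / (S T + 1) ℤ^8 ≠ 0` (by machine `≅ ℤ/3`, as at `g = 4`: `normSum_eq_zero_not_coboundary_four`; the pattern
«`Ĥ⁻¹ ≅ ℤ/3` iff `g ≡ 1 (mod 3)`» is recorded for `g ≤ 30` in HOME `widen/LIT-W/UTATE-EVERY-G-litw-mukai-g19.md` §2bis and is
NOT a theorem of this file). Arithmetic of the `8`-dimensional theta-power model only.
[cite: Mukai1981, Thm. 3.13 (6) and (3.14) (p. 163)] -/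
theorem normSum_eq_zero_not_coboundary_seven :
    normSum ℤ 7 ![0, 2, 0, -1, 0, 1, 0, 0] = 0 ∧
    (¬ ∃ v : Fin 8 → ℤ, (fourier ℤ 7 * twist ℤ 7 1) *ᵥ v + v = ![0, 2, 0, -1, 0, 1, 0, 0]) ∧
    (fourier ℤ 7 * twist ℤ 7 1) *ᵥ ![0, 3, -2, 3, -6, 7, -3, 0] + ![0, 3, -2, 3, -6, 7, -3, 0] =
      3 • ![0, 2, 0, -1, 0, 1, 0, 0] := by
  refine ⟨?_, ?_, ?_⟩
  · rw [normSum_seven]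
    ext m; fin_cases m <;> simp
  · rintro ⟨v, hv⟩
    rw [fourier_mul_twist_mulVec_seven] at hv
    have h0 := congr_fun hv 0
    have h1 := congr_fun hv 1
    have h2 := congr_fun hv 2
    have h3 := congr_fun hv 3
    have h4 := congr_fun hv 4
    have h5 := congr_fun hv 5
    have h6 := congr_fun hv 6
    have h7 := congr_fun hv 7
    simp at h0 h1 h2 h3 h4 h5 h6 h7
    omega
  · rw [fourier_mul_twist_mulVec_seven]
    ext m; fin_cases m <;> simp

/-! #### `g = 9` (the second power of `3`: index `3`, detected by `f_0 mod 3`) -/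

/-- `Ψ^H = S T` at `g = 9` on `f = (f₀, …, f₉)` (coordinates `θ^j/j!`), written out.
[cite: Mukai1981, Thm. 3.13 (5)–(6) and (3.14) (p. 163)] -/
theorem fourier_mul_twist_mulVec_nine (f : Fin 10 → R) :
    (fourier R 9 * twist R 9 1) *ᵥ f =
      ![f 0 + 9 * f 1 + 36 * f 2 + 84 * f 3 + 126 * f 4 + 126 * f 5 + 84 * f 6 + 36 * f 7 + 9 * f 8 + f 9,
        -(f 0 + 8 * f 1 + 28 * f 2 + 56 * f 3 + 70 * f 4 + 56 * f 5 + 28 * f 6 + 8 * f 7 + f 8),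
        f 0 + 7 * f 1 + 21 * f 2 + 35 * f 3 + 35 * f 4 + 21 * f 5 + 7 * f 6 + f 7,
        -(f 0 + 6 * f 1 + 15 * f 2 + 20 * f 3 + 15 * f 4 + 6 * f 5 + f 6),
        f 0 + 5 * f 1 + 10 * f 2 + 10 * f 3 + 5 * f 4 + f 5,
        -(f 0 + 4 * f 1 + 6 * f 2 + 4 * f 3 + f 4),
        f 0 + 3 * f 1 + 3 * f 2 + f 3,
        -(f 0 + 2 * f 1 + f 2),
        f 0 + f 1,
        -f 0] := by
  ext m
  rw [fourier_mul_twist_mulVec_apply]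
  fin_cases m <;> simp [Fin.sum_univ_succ, Nat.choose] <;> ring

/-- The norm `N₉ f = f - Ψ f + Ψ² f` at `g = 9`, written out (`N₉(e₀) = (0,1,-1,1,-1,1,-1,1,-1,0)`; every entry of row `0`
is a multiple of `3`). [cite: Mukai1981, Thm. 3.13 (6) and (3.14) (p. 163)] -/
theorem normSum_nine (f : Fin 10 → R) :
    normSum R 9 f =
      ![-(9 * f 1 + 36 * f 2 + 84 * f 3 + 126 * f 4 + 126 * f 5 + 84 * f 6 + 36 * f 7 + 9 * f 8),
        f 0 + 9 * f 1 + 28 * f 2 + 56 * f 3 + 70 * f 4 + 56 * f 5 + 28 * f 6 + 8 * f 7 - f 9,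
        -f 0 - 7 * f 1 - 20 * f 2 - 35 * f 3 - 35 * f 4 - 21 * f 5 - 7 * f 6 + 2 * f 8 + f 9,
        f 0 + 6 * f 1 + 15 * f 2 + 21 * f 3 + 15 * f 4 + 6 * f 5 - 3 * f 7 - 3 * f 8 - f 9,
        -f 0 - 5 * f 1 - 10 * f 2 - 10 * f 3 - 4 * f 4 + 4 * f 6 + 6 * f 7 + 4 * f 8 + f 9,
        f 0 + 4 * f 1 + 6 * f 2 + 4 * f 3 - 4 * f 5 - 10 * f 6 - 10 * f 7 - 5 * f 8 - f 9,
        -f 0 - 3 * f 1 - 3 * f 2 + 6 * f 4 + 15 * f 5 + 21 * f 6 + 15 * f 7 + 6 * f 8 + f 9,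
        f 0 + 2 * f 1 - 7 * f 3 - 21 * f 4 - 35 * f 5 - 35 * f 6 - 20 * f 7 - 7 * f 8 - f 9,
        -f 0 + 8 * f 2 + 28 * f 3 + 56 * f 4 + 70 * f 5 + 56 * f 6 + 28 * f 7 + 9 * f 8 + f 9,
        -(9 * f 1 + 36 * f 2 + 84 * f 3 + 126 * f 4 + 126 * f 5 + 84 * f 6 + 36 * f 7 + 9 * f 8)] := by
  have hf : f = ![f 0, f 1, f 2, f 3, f 4, f 5, f 6, f 7, f 8, f 9] := by ext m; fin_cases m <;> rfl
  rw [normSum_eq, fourier_mul_twist_mulVec_nine, fourier_mul_twist_mulVec_nine]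
  conv_lhs => rw [hf]
  ext m; fin_cases m <;> simp <;> ring

/-- **The integral `Ψ^H`-anti-fixed lattice at `g = 9`, written out**: an integer class `f ∈ ℤ^10` satisfies `S T f = -f`
iff `f = a b₁ + b b₂ + c b₃ + d b₄` with `b₁ = (1,0,6,0,-14,23,-19,7,-1,1)`, `b₂ = (0,1,6,0,-15,25,-21,8,-1,0)`,
`b₃ = (0,0,7,0,-16,26,-21,7,0,0)`, `b₄ = (0,0,0,1,-2,2,-1,0,0,0)` (row-Hermite basis, pivots `1, 1, 7, 1`; rank `4 = famCard 9`;
`a = f₀`, `b = f₁`, `c = (f₂ - 6f₀ - 6f₁)/7`, `d = f₃`). In particular `b₁` is an integral anti-fixed class with `f₀ = 1`: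
at `g = 9 = 3²` the `e₀`-coordinate of `Fix^ℤ₉` is NOT divisible by `3` (the prime-power law
`natCast_dvd_apply_zero_of_mulVec_eq_pow` genuinely excludes `p = 3`). [cite: Mukai1981, Thm. 3.13 (6) and (3.14) (p. 163)] -/
theorem fourier_mul_twist_mulVec_eq_neg_iff_nine (f : Fin 10 → ℤ) :
    (fourier ℤ 9 * twist ℤ 9 1) *ᵥ f = -f ↔ ∃ a b c d : ℤ,
      a • (![1, 0, 6, 0, -14, 23, -19, 7, -1, 1] : Fin 10 → ℤ) + b • ![0, 1, 6, 0, -15, 25, -21, 8, -1, 0] +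
        c • ![0, 0, 7, 0, -16, 26, -21, 7, 0, 0] + d • ![0, 0, 0, 1, -2, 2, -1, 0, 0, 0] = f := by
  rw [fourier_mul_twist_mulVec_nine]
  constructor
  · intro h
    have h0 := congr_fun h 0
    have h1 := congr_fun h 1
    have h2 := congr_fun h 2
    have h3 := congr_fun h 3
    have h4 := congr_fun h 4
    have h5 := congr_fun h 5
    have h6 := congr_fun h 6
    have h7 := congr_fun h 7
    have h8 := congr_fun h 8
    have h9 := congr_fun h 9
    simp at h0 h1 h2 h3 h4 h5 h6 h7 h8 h9
    refine ⟨f 0, f 1, (f 2 - 6 * f 0 - 6 * f 1) / 7, f 3, ?_⟩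
    ext m; fin_cases m <;> simp <;> omega
  · rintro ⟨a, b, c, d, rfl⟩
    ext m; fin_cases m <;> simp <;> ring

/-- **At `g = 9` an integral class is a norm iff it is `Ψ^H`-anti-fixed with `e₀`-coordinate divisible by `3`**:
`N₉(ℤ^10) = {f ∈ Fix^ℤ₉ : 3 ∣ f₀}` — (→) norms are anti-fixed (`fourier_mul_twist_mulVec_normSum`) and row `0` of `N₉` is
divisible by `3` (`3 ∣ C(9,k)`, `0 < k < 9`; `dvd_normSum_apply_zero_of_odd`); (←) `3 b₁ = N₉(-105,91,-31,-1,3,0,…)`,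
`b₂ = N₉(-39,34,-12,0,1,0,…)`, `b₃ = N₉(-48,38,-13,0,1,0,…)`, `b₄ = N₉(-8,4,-1,0,…)` for the basis of
`fourier_mul_twist_mulVec_eq_neg_iff_nine`. The same shape holds at `g = 3` (`N₃(ℤ^4) = ℤ(3,0,-3,3) ⊕ ℤ(0,1,-1,0)` inside
`Fix^ℤ₃ = ℤ(1,0,-1,1) ⊕ ℤ(0,1,-1,0)`, `fourier_mul_twist_mulVec_eq_neg_iff_three`). Lattice arithmetic in the theta-power
model only. [cite: Mukai1981, Thm. 3.13 (6) and (3.14) (p. 163)] -/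
theorem exists_normSum_eq_iff_three_dvd_nine (f : Fin 10 → ℤ) :
    (∃ u : Fin 10 → ℤ, normSum ℤ 9 u = f) ↔ (fourier ℤ 9 * twist ℤ 9 1) *ᵥ f = -f ∧ (3 : ℤ) ∣ f 0 := by
  constructor
  · rintro ⟨u, rfl⟩
    refine ⟨?_, ?_⟩
    · rw [fourier_mul_twist_mulVec_normSum, show ((-1 : ℤ) ^ 9) = -1 by norm_num, neg_one_smul]
    · have h0 := congr_fun (normSum_nine u) 0
      simp at h0
      omega
  · rintro ⟨hf, h3⟩
    obtain ⟨a, b, c, d, rfl⟩ := (fourier_mul_twist_mulVec_eq_neg_iff_nine _).mp hf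
    simp at h3
    obtain ⟨a', rfl⟩ := h3
    refine ⟨![-(105 * a') - 39 * b - 48 * c - 8 * d, 91 * a' + 34 * b + 38 * c + 4 * d,
      -(31 * a') - 12 * b - 13 * c - d, -a', 3 * a' + b + c, 0, 0, 0, 0, 0], ?_⟩
    rw [normSum_nine]
    ext m; fin_cases m <;> simp <;> ring

/-- **The norm sublattice at `g = 9`, written out**: `N₉(ℤ^10) = ℤ n₁ ⊕ ℤ b₂ ⊕ ℤ b₃ ⊕ ℤ b₄` with
`n₁ = (3,0,4,0,-10,17,-15,7,-3,3) = 3 b₁ - 2 b₃` and `b₂, b₃, b₄` as in `fourier_mul_twist_mulVec_eq_neg_iff_nine`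
(row-Hermite basis, pivots `3, 1, 7, 1`; `n₁ = N₉(-9,15,-5,-1,1,0,…)`, `normSum_nine_examples`). Against the anti-fixed
lattice `ℤ b₁ ⊕ ℤ b₂ ⊕ ℤ b₃ ⊕ ℤ b₄`: elementary divisors `(3, 1, 1, 1)`, **`Fix^ℤ₉ / N₉(ℤ^10) ≅ ℤ/3`** — the `g = 9` clause of
the pattern «index `3` iff `3 ∣ g`» (machine for `g ≤ 60` in HOME `widen/LIT-W/UTATE-EVERY-G-litw-mukai-g19.md`; kernel
instances `g = 3, …, 7` above). [cite: Mukai1981, Thm. 3.13 (6) and (3.14) (p. 163)] -/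
theorem exists_normSum_eq_iff_nine (f : Fin 10 → ℤ) :
    (∃ u : Fin 10 → ℤ, normSum ℤ 9 u = f) ↔ ∃ a b c d : ℤ,
      a • (![3, 0, 4, 0, -10, 17, -15, 7, -3, 3] : Fin 10 → ℤ) + b • ![0, 1, 6, 0, -15, 25, -21, 8, -1, 0] +
        c • ![0, 0, 7, 0, -16, 26, -21, 7, 0, 0] + d • ![0, 0, 0, 1, -2, 2, -1, 0, 0, 0] = f := by
  rw [exists_normSum_eq_iff_three_dvd_nine, fourier_mul_twist_mulVec_eq_neg_iff_nine]
  constructor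
  · rintro ⟨⟨a, b, c, d, rfl⟩, h3⟩
    simp at h3
    obtain ⟨a', rfl⟩ := h3
    refine ⟨a', b, c + 2 * a', d, ?_⟩
    ext m; fin_cases m <;> simp <;> ring
  · rintro ⟨a, b, c, d, rfl⟩
    refine ⟨⟨3 * a, b, c - 2 * a, d, ?_⟩, ?_⟩
    · ext m; fin_cases m <;> simp <;> ring
    · simp

/-- **The quotient `Fix^ℤ₉ / N₉(ℤ^10) ≅ ℤ/3` is generated by the class of `b₁ = (1,0,6,0,-14,23,-19,7,-1,1)`**: every integral
anti-fixed class `f` at `g = 9` is a norm, or `f - b₁` is, or `f + b₁` is (by `f₀ mod 3`), and `b₁` itself is NOT a norm.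
[cite: Mukai1981, Thm. 3.13 (6) and (3.14) (p. 163)] -/
theorem exists_normSum_eq_or_nine (f : Fin 10 → ℤ) (hf : (fourier ℤ 9 * twist ℤ 9 1) *ᵥ f = -f) :
    ((∃ u : Fin 10 → ℤ, normSum ℤ 9 u = f) ∨
      (∃ u : Fin 10 → ℤ, normSum ℤ 9 u = f - ![1, 0, 6, 0, -14, 23, -19, 7, -1, 1]) ∨
      (∃ u : Fin 10 → ℤ, normSum ℤ 9 u = f + ![1, 0, 6, 0, -14, 23, -19, 7, -1, 1])) ∧
    ¬ ∃ u : Fin 10 → ℤ, normSum ℤ 9 u = ![1, 0, 6, 0, -14, 23, -19, 7, -1, 1] := by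
  have hb : (fourier ℤ 9 * twist ℤ 9 1) *ᵥ (![1, 0, 6, 0, -14, 23, -19, 7, -1, 1] : Fin 10 → ℤ) =
      -![1, 0, 6, 0, -14, 23, -19, 7, -1, 1] := by
    rw [fourier_mul_twist_mulVec_nine]; ext m; fin_cases m <;> simp
  refine ⟨?_, ?_⟩
  · rcases (by omega : f 0 % 3 = 0 ∨ f 0 % 3 = 1 ∨ f 0 % 3 = 2) with h | h | h
    · refine Or.inl ((exists_normSum_eq_iff_three_dvd_nine f).mpr ⟨hf, ?_⟩)
      omega
    · refine Or.inr (Or.inl ((exists_normSum_eq_iff_three_dvd_nine _).mpr ⟨?_, ?_⟩))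
      · rw [Matrix.mulVec_sub, hf, hb, neg_sub_neg, neg_sub]
      · have : (f - (![1, 0, 6, 0, -14, 23, -19, 7, -1, 1] : Fin 10 → ℤ)) 0 = f 0 - 1 := by simp
        rw [this]; omega
    · refine Or.inr (Or.inr ((exists_normSum_eq_iff_three_dvd_nine _).mpr ⟨?_, ?_⟩))
      · rw [Matrix.mulVec_add, hf, hb, neg_add]
      · have : (f + (![1, 0, 6, 0, -14, 23, -19, 7, -1, 1] : Fin 10 → ℤ)) 0 = f 0 + 1 := by simp
        rw [this]; omega
  · rw [exists_normSum_eq_iff_three_dvd_nine]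
    rintro ⟨-, h3⟩
    simp at h3

/-- Norms at `g = 9`, written out: `N₉(e₀) = (0,1,-1,1,-1,1,-1,1,-1,0)`, and the basis preimages
`N₉(-9,15,-5,-1,1,0,…) = n₁ = (3,0,4,0,-10,17,-15,7,-3,3)`, `N₉(-8,4,-1,0,…) = b₄ = (0,0,0,1,-2,2,-1,0,0,0)`,
`N₉(-39,34,-12,0,1,0,…) = b₂`, `N₉(-48,38,-13,0,1,0,…) = b₃`. [cite: Mukai1981, Thm. 3.13 (6) and (3.14) (p. 163)] -/
theorem normSum_nine_examples :
    normSum ℤ 9 ![1, 0, 0, 0, 0, 0, 0, 0, 0, 0] = ![0, 1, -1, 1, -1, 1, -1, 1, -1, 0] ∧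
    normSum ℤ 9 ![-9, 15, -5, -1, 1, 0, 0, 0, 0, 0] = ![3, 0, 4, 0, -10, 17, -15, 7, -3, 3] ∧
    normSum ℤ 9 ![-8, 4, -1, 0, 0, 0, 0, 0, 0, 0] = ![0, 0, 0, 1, -2, 2, -1, 0, 0, 0] ∧
    normSum ℤ 9 ![-39, 34, -12, 0, 1, 0, 0, 0, 0, 0] = ![0, 1, 6, 0, -15, 25, -21, 8, -1, 0] ∧
    normSum ℤ 9 ![-48, 38, -13, 0, 1, 0, 0, 0, 0, 0] = ![0, 0, 7, 0, -16, 26, -21, 7, 0, 0] := by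
  refine ⟨?_, ?_, ?_, ?_, ?_⟩ <;> (rw [normSum_nine]; ext m; fin_cases m <;> simp)

/-- **The Euler form on the integral anti-fixed lattice `Fix^ℤ₉` is alternating** (`g` odd), written out on the basis
`b₁, b₂, b₃, b₄` of `fourier_mul_twist_mulVec_eq_neg_iff_nine`: `χ(b₁,b₂) = -423`, `χ(b₁,b₃) = 252`, `χ(b₁,b₄) = 672`,
`χ(b₂,b₃) = 756`, `χ(b₂,b₄) = 756`, `χ(b₃,b₄) = 756`, `χ(bᵢ,bᵢ) = 0`. Pure arithmetic of `χ(v, w) = Σ_j (-1)^j C(9, j) v_j w_{9-j}`.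
[cite: Mukai1987FourierFunctor, (1.19)–(1.20) (p. 527)] -/
theorem euler_nine_intBasis :
    euler ℤ 9 ![1, 0, 6, 0, -14, 23, -19, 7, -1, 1] ![0, 1, 6, 0, -15, 25, -21, 8, -1, 0] = -423 ∧
    euler ℤ 9 ![1, 0, 6, 0, -14, 23, -19, 7, -1, 1] ![0, 0, 7, 0, -16, 26, -21, 7, 0, 0] = 252 ∧
    euler ℤ 9 ![1, 0, 6, 0, -14, 23, -19, 7, -1, 1] ![0, 0, 0, 1, -2, 2, -1, 0, 0, 0] = 672 ∧
    euler ℤ 9 ![0, 1, 6, 0, -15, 25, -21, 8, -1, 0] ![0, 0, 7, 0, -16, 26, -21, 7, 0, 0] = 756 ∧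
    euler ℤ 9 ![0, 1, 6, 0, -15, 25, -21, 8, -1, 0] ![0, 0, 0, 1, -2, 2, -1, 0, 0, 0] = 756 ∧
    euler ℤ 9 ![0, 0, 7, 0, -16, 26, -21, 7, 0, 0] ![0, 0, 0, 1, -2, 2, -1, 0, 0, 0] = 756 ∧
    euler ℤ 9 ![1, 0, 6, 0, -14, 23, -19, 7, -1, 1] ![1, 0, 6, 0, -14, 23, -19, 7, -1, 1] = 0 := by
  refine ⟨?_, ?_, ?_, ?_, ?_, ?_, ?_⟩ <;> norm_num [euler, Fin.sum_univ_succ, Fin.rev, Nat.choose]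

end IntegralFixedLattices

section SeedKernel

/-! ### The seed kernel law: `χ(e^{xθ}, Ψ^H e^{yθ}) = ε (1 + x + xy)^g`, every `g`, every commutative ring -/

variable (g : ℕ)

/-- **`Ψ^H` on a slope class, over any commutative ring, coordinatewise**: `(S T e^{yθ})_m = (-1)^m (1 + y)^{g-m}`
(`T e^{yθ} = e^{(1+y)θ}`, then `(S v)_m = (-1)^m v_{g-m}`); over a field with `1 + y ≠ 0` this is the leaf's
`fourier_mul_twist_mulVec_thetaExp` `= (1+y)^g e^{-θ/(1+y)}`. [cite: Mukai1981, Thm. 3.13 (5)–(6) and (3.14) (p. 163)]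
[cite: Beauville1983FourierChow, Prop. 5 (p. 248)] -/
theorem fourier_mul_twist_mulVec_thetaExp_apply (y : R) (m : Fin (g + 1)) :
    ((fourier R g * twist R g 1) *ᵥ thetaExp R g y) m = (-1 : R) ^ (m : ℕ) * (1 + y) ^ (g - (m : ℕ)) := by
  rw [← Matrix.mulVec_mulVec, twist_mulVec_thetaExp, fourier_mulVec_thetaExp]

/-- **The seed kernel law, every `g`, every commutative ring**: `χ(e^{xθ}, Ψ^H e^{yθ}) = (-1)^g (1 + x + x y)^g` — for
line bundles `𝒪(xΘ)`, `𝒪(yΘ)` (`x, y ∈ ℤ`) on a principally polarized abelian `g`-fold this is the Euler characteristic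
`χ(𝒪(xΘ), Ψ 𝒪(yΘ))` up to the sign `(-1)^g` of the shift hidden in `Ψ` (at `g = 6`: `(xy + x + 1)^6`, HOME
`s4push/search-3` N6-TABLE-3 row U-SEED-KER). From `(Ψ e^{yθ})_{g-j} = (-1)^{g-j}(1+y)^j`, `χ(v,w) = Σ_j (-1)^j C(g,j) v_j w_{g-j}`
and the binomial theorem; no invertibility of `1 + y` needed. [cite: Mukai1987FourierFunctor, (1.19)–(1.20) (p. 527)]
[cite: Mukai1981, Thm. 3.13 (5)–(6) and (3.14) (p. 163)] -/
theorem euler_thetaExp_fourier_mul_twist_mulVec_thetaExp (x y : R) :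
    euler R g (thetaExp R g x) ((fourier R g * twist R g 1) *ᵥ thetaExp R g y) =
      (-1 : R) ^ g * (1 + x + x * y) ^ g := by
  have key : ∀ j : Fin (g + 1),
      (-1 : R) ^ (j : ℕ) * (g.choose j : R) * thetaExp R g x j *
          ((fourier R g * twist R g 1) *ᵥ thetaExp R g y) (Fin.rev j) =
        (-1 : R) ^ g * ((x * (1 + y)) ^ (j : ℕ) * (1 : R) ^ (g - (j : ℕ)) * (g.choose (j : ℕ) : R)) := by
    intro j
    have hj : (j : ℕ) ≤ g := j.is_le
    rw [thetaExp_apply, fourier_mul_twist_mulVec_thetaExp_apply, val_rev_eq, Nat.sub_sub_self hj, one_pow,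
      mul_one, mul_pow]
    have hs : (-1 : R) ^ (j : ℕ) * (-1 : R) ^ (g - (j : ℕ)) = (-1 : R) ^ g := by
      rw [← pow_add, Nat.add_sub_cancel' hj]
    calc (-1 : R) ^ (j : ℕ) * (g.choose j : R) * x ^ (j : ℕ) * ((-1 : R) ^ (g - (j : ℕ)) * (1 + y) ^ (j : ℕ))
        = ((-1 : R) ^ (j : ℕ) * (-1 : R) ^ (g - (j : ℕ))) * (x ^ (j : ℕ) * (1 + y) ^ (j : ℕ) * (g.choose j : R)) := by
          ring
      _ = (-1 : R) ^ g * (x ^ (j : ℕ) * (1 + y) ^ (j : ℕ) * (g.choose (j : ℕ) : R)) := by rw [hs]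
  rw [euler, Finset.sum_congr rfl fun j _ => key j, ← Finset.mul_sum,
    Fin.sum_univ_eq_sum_range (fun j => (x * (1 + y)) ^ j * (1 : R) ^ (g - j) * (g.choose j : R)) (g + 1),
    ← add_pow, show x * (1 + y) + 1 = 1 + x + x * y by ring]

/-- The seed kernel law at `g = 6`: `χ(e^{xθ}, Ψ^H e^{yθ}) = (xy + x + 1)^6` (N6-TABLE-3 row U-SEED-KER «χ(𝒪(xΘ), Ψ𝒪(yΘ)) =
(xy+x+1)⁶»). [cite: Mukai1987FourierFunctor, (1.19)–(1.20) (p. 527)] -/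
theorem euler_thetaExp_fourier_mul_twist_mulVec_thetaExp_six (x y : R) :
    euler R 6 (thetaExp R 6 x) ((fourier R 6 * twist R 6 1) *ᵥ thetaExp R 6 y) = (x * y + x + 1) ^ 6 := by
  rw [euler_thetaExp_fourier_mul_twist_mulVec_thetaExp, show (1 : R) + x + x * y = x * y + x + 1 by ring]
  norm_num

end SeedKernel

section EisensteinCongruence

/-! #### The Eisenstein congruence `π⁶ ≡ N(π)³ (mod 9λ)` in `ℤ[ζ₃]` (HOME `s4push/search-3` N6-TABLE-3 row U-EIS), every `π` -/

variable {ω : R} (hω : ω ^ 2 + ω + 1 = 0)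
include hω

/-- `λ² = -3ω` for `λ = 1 - ω` (`3 = -ω²(1-ω)²`). [cite: IrelandRosen1990, Ch. 9 §1, Prop. 9.1.4] -/
private theorem one_sub_omega_sq : (1 - ω) ^ 2 = -3 * ω := by
  linear_combination hω

/-- The factorisation behind U-EIS: for `π = a + bω`, `N(π) = a² - ab + b²` (`= π π̄`), one has
`π⁶ - N(π)³ = π³(π³ - π̄³)` and `π³ - π̄³ = (π - π̄)(π - ωπ̄)(π - ω²π̄) = (bωλ)((a-b)λ)(-aω²λ)`, so
`π⁶ - N(π)³ = -ab(a-b) λ³ π³`, `λ = 1 - ω` — a polynomial identity modulo `ω² + ω + 1`.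
[cite: IrelandRosen1990, Ch. 9 §1, Prop. 9.1.1–9.1.4] -/
theorem pow_six_sub_norm_cube_eq (a b : R) :
    (a + b * ω) ^ 6 - (a ^ 2 - a * b + b ^ 2) ^ 3 = -(a * b * (a - b)) * (1 - ω) ^ 3 * (a + b * ω) ^ 3 := by
  linear_combination (b ^ 6 * ω ^ 4 + a * b ^ 5 * ω ^ 4 + (-1) * a ^ 2 * b ^ 4 * ω ^ 4 + (-1) * b ^ 6 * ω ^ 3
    + 2 * a * b ^ 5 * ω ^ 3 + 7 * a ^ 2 * b ^ 4 * ω ^ 3 + -3 * a ^ 3 * b ^ 3 * ω ^ 3 + -3 * a ^ 2 * b ^ 4 * ω ^ 2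
    + 15 * a ^ 3 * b ^ 3 * ω ^ 2 + -3 * a ^ 4 * b ^ 2 * ω ^ 2 + b ^ 6 * ω + -3 * a * b ^ 5 * ω + 6 * a ^ 2 * b ^ 4 * ω
    + -10 * a ^ 3 * b ^ 3 * ω + 13 * a ^ 4 * b ^ 2 * ω + (-1) * a ^ 5 * b * ω + (-1) * b ^ 6 + 3 * a * b ^ 5
    + -6 * a ^ 2 * b ^ 4 + 7 * a ^ 3 * b ^ 3 + -7 * a ^ 4 * b ^ 2 + 4 * a ^ 5 * b) * hω

/-- **U-EIS, every Eisenstein integer** (HOME `s4push/search-3/N6-TABLE-3.md` row U-EIS, there a THEOREM-CANDIDATE with a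
hand proof read ×2 across seats and a machine box `(a,b) ∈ [-40,40]²`): in any commutative ring with an element `ω`,
`ω² + ω + 1 = 0` (e.g. `ℤ[ζ₃] = ℤ[X]/(X² + X + 1)`), for all integers `a, b` the element `π = a + bω` satisfies
**`9λ ∣ π⁶ - N(π)³`**, `λ = 1 - ω`, `N(π) = a² - ab + b²`. Proof as on the row: `π⁶ - N(π)³ = -ab(a-b)λ³π³`
(`pow_six_sub_norm_cube_eq`); either `3 ∣ ab(a-b)` — then `-3m λ³ π³ = 9λ · (m ω π³)` by `λ² = -3ω` — or `a ≡ -b ≢ 0 (mod 3)`,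
i.e. `3 ∣ a + b`, and then `π = aλ + (a+b)ω = λ(a - nλ)` (`3 = -ω²λ²`), so `λ ∣ π` and `λ⁶ = 9λ · λω²` divides the right
side. Sharpness at `π = 4 + ζ₃` — `π⁶ - N³ = -684 + 2520ζ₃ ∉ 27ℤ[ζ₃]`, so `λ⁶ ∤` — is
`not_dvd_pow_six_sub_norm_cube_four_add_root`. Pure arithmetic of `ℤ[ζ₃]`; no abelian variety in it. [cite: IrelandRosen1990, Ch. 9 §1, Prop. 9.1.1–9.1.4] -/
theorem nine_mul_one_sub_omega_dvd_pow_six_sub_norm_cube (a b : ℤ) :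
    9 * (1 - ω) ∣ ((a : R) + b * ω) ^ 6 - ((a : R) ^ 2 - a * b + (b : R) ^ 2) ^ 3 := by
  rw [pow_six_sub_norm_cube_eq hω]
  have hlam2 := one_sub_omega_sq hω
  have key : (3 : ℤ) ∣ a * b * (a - b) ∨ (3 : ℤ) ∣ a + b := by
    rcases (by omega : a % 3 = 0 ∨ a % 3 = 1 ∨ a % 3 = 2) with ha | ha | ha <;>
    rcases (by omega : b % 3 = 0 ∨ b % 3 = 1 ∨ b % 3 = 2) with hb | hb | hb <;>
    first
      | exact Or.inl (((Int.dvd_of_emod_eq_zero ha).mul_right b).mul_right (a - b))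
      | exact Or.inl (((Int.dvd_of_emod_eq_zero hb).mul_left a).mul_right (a - b))
      | exact Or.inl ((show (3 : ℤ) ∣ a - b by omega).mul_left (a * b))
      | exact Or.inr (by omega)
  rcases key with h | h
  rotate_left
  · -- `3 ∣ a + b`: `λ ∣ π`
    obtain ⟨n, hn⟩ := h
    have hn' : (a : R) + b = 3 * n := by
      have e := congrArg (fun z : ℤ => (z : R)) hn
      push_cast at e
      exact e
    have hπ : (a : R) + b * ω = (1 - ω) * (a - n * (1 - ω)) := by
      linear_combination ω * hn' + (n : R) * hω
    have h6 : (1 - ω) ^ 6 = 9 * (1 - ω) * ((1 - ω) * ω ^ 2) := by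
      linear_combination ((1 - ω) ^ 2 * ((1 - ω) ^ 2 - 3 * ω)) * hω
    rw [hπ]
    refine ⟨(1 - ω) * ω ^ 2 * (-((a : R) * b * (a - b)) * ((a : R) - n * (1 - ω)) ^ 3), ?_⟩
    linear_combination (-((a : R) * b * (a - b)) * ((a : R) - n * (1 - ω)) ^ 3) * h6
  · obtain ⟨m, hm⟩ := h
    have hm' : (a : R) * b * (a - b) = 3 * m := by
      have e := congrArg (fun z : ℤ => (z : R)) hm
      push_cast at e
      exact e
    exact ⟨m * ω * ((a : R) + b * ω) ^ 3, by
      linear_combination (-(1 - ω) ^ 3 * ((a : R) + b * ω) ^ 3) * hm'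
        - 3 * (m : R) * (1 - ω) * ((a : R) + b * ω) ^ 3 * hlam2⟩

omit hω in
open Polynomial in
/-- The instance `ℤ[ζ₃] = ℤ[X]/(X² + X + 1)` (the ring of section `ZetaSixPlane`'s transfer argument): for all integers
`a, b`, `9(1 - ζ₃) ∣ (a + bζ₃)⁶ - (a² - ab + b²)³`. [cite: IrelandRosen1990, Ch. 9 §1, Prop. 9.1.4] -/
theorem nine_mul_one_sub_root_dvd_pow_six_sub_norm_cube (a b : ℤ) :
    (9 : AdjoinRoot (X ^ 2 + X + 1 : ℤ[X])) * (1 - AdjoinRoot.root (X ^ 2 + X + 1 : ℤ[X])) ∣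
      ((a : AdjoinRoot (X ^ 2 + X + 1 : ℤ[X])) + (b : AdjoinRoot (X ^ 2 + X + 1 : ℤ[X])) * AdjoinRoot.root (X ^ 2 + X + 1 : ℤ[X])) ^ 6
        - ((a : AdjoinRoot (X ^ 2 + X + 1 : ℤ[X])) ^ 2
          - (a : AdjoinRoot (X ^ 2 + X + 1 : ℤ[X])) * (b : AdjoinRoot (X ^ 2 + X + 1 : ℤ[X]))
          + (b : AdjoinRoot (X ^ 2 + X + 1 : ℤ[X])) ^ 2) ^ 3 := by
  exact nine_mul_one_sub_omega_dvd_pow_six_sub_norm_cube root_sq_add_root_add_one a b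

omit hω in
open Polynomial in
/-- **U-EIS is sharp**: at `π = 4 + ζ₃` (`N(π) = 13`), `π⁶ - N(π)³ = -684 + 2520 ζ₃` is NOT divisible by `27` (`= -ζ₃² λ⁶`,
i.e. not by `λ⁶`) in `ℤ[ζ₃] = ℤ[X]/(X² + X + 1)` — `684 = 27 · 25 + 9`; read off the constant coefficient of the normal form
modulo the monic `X² + X + 1` (`AdjoinRoot.modByMonicHom`). The numbers are those of HOME `s4push/search-3/N6-TABLE-3.md` row
U-EIS («sharp at π = 4 + ζ»). [cite: IrelandRosen1990, Ch. 9 §1, Prop. 9.1.4] -/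
theorem not_dvd_pow_six_sub_norm_cube_four_add_root :
    ¬ (27 : AdjoinRoot (X ^ 2 + X + 1 : ℤ[X])) ∣
      ((4 : AdjoinRoot (X ^ 2 + X + 1 : ℤ[X])) + AdjoinRoot.root (X ^ 2 + X + 1 : ℤ[X])) ^ 6 - 13 ^ 3 := by
  have hmon : (X ^ 2 + X + 1 : ℤ[X]).Monic := by monicity!
  have hθ := root_sq_add_root_add_one
  -- the value, reduced modulo `θ² + θ + 1`: `-684 + 2520 θ`
  have hx : ((4 : AdjoinRoot (X ^ 2 + X + 1 : ℤ[X])) + AdjoinRoot.root (X ^ 2 + X + 1 : ℤ[X])) ^ 6 - 13 ^ 3 =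
      AdjoinRoot.mk (X ^ 2 + X + 1 : ℤ[X]) (C 2520 * X + C (-684)) := by
    rw [map_add, map_mul, AdjoinRoot.mk_C, AdjoinRoot.mk_C, AdjoinRoot.mk_X, eq_intCast, eq_intCast]
    push_cast
    linear_combination ((2583 : AdjoinRoot (X ^ 2 + X + 1 : ℤ[X])) + 1041 * AdjoinRoot.root (X ^ 2 + X + 1 : ℤ[X])
      + 216 * AdjoinRoot.root (X ^ 2 + X + 1 : ℤ[X]) ^ 2 + 23 * AdjoinRoot.root (X ^ 2 + X + 1 : ℤ[X]) ^ 3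
      + AdjoinRoot.root (X ^ 2 + X + 1 : ℤ[X]) ^ 4) * hθ
  rintro ⟨q, hq⟩
  have hq' : AdjoinRoot.mk (X ^ 2 + X + 1 : ℤ[X]) (C 2520 * X + C (-684)) = (27 : ℤ) • q := by
    rw [← hx, hq, zsmul_eq_mul]
    push_cast
    rfl
  have hc := congrArg (fun z => ((AdjoinRoot.modByMonicHom hmon z).coeff 0)) hq'
  simp only [AdjoinRoot.modByMonicHom_mk, map_zsmul, coeff_smul, smul_eq_mul] at hc
  have hdeg : (C 2520 * X + C (-684) : ℤ[X]).degree < (X ^ 2 + X + 1 : ℤ[X]).degree := by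
    refine lt_of_le_of_lt degree_linear_le ?_
    rw [show (X ^ 2 + X + 1 : ℤ[X]).degree = 2 by compute_degree!]
    norm_num
  rw [(modByMonic_eq_self_iff hmon).mpr hdeg, coeff_add, coeff_C_mul, coeff_X_zero, mul_zero, zero_add,
    coeff_C_zero] at hc
  omega

end EisensteinCongruence

section ThetaScale

/-! ### The substitution `θ ↦ cθ` and the non-principal cube law `(T_n P_n S)³ = (-1)^g n^{3g}` ([Muk81] (3.12) for `N = nΘ`) -/

variable (g : ℕ)

variable (R) in
/-- `D_c := diag(c^k)`, the substitution `θ ↦ cθ` on the theta powers `θ^k/k!`. For an integer `n`, `D_{n²} = D_n²` is the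
class of the pullback `n_X^*` along multiplication by `n` (which acts on `H^{2k}(X, ℚ)` by `n^{2k}`); with `φ_{nΘ} = φ_Θ ∘ n_X`
this is the ingredient of [Mukai1981] Prop. 3.11 (1) and (3.12) for the non-principal polarization `N = 𝒪(nΘ)` of a
principally polarized abelian variety. [cite: Mukai1981, Prop. 3.11 (1) and (3.12) (p. 162)] -/
def thetaScale (c : R) : Matrix (Fin (g + 1)) (Fin (g + 1)) R := Matrix.diagonal fun k => c ^ (k : ℕ)

/-- Entries of `D_c`. [cite: Mukai1981, Prop. 3.11 (1) and (3.12) (p. 162)] -/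
@[simp] theorem thetaScale_apply (c : R) (m k : Fin (g + 1)) :
    thetaScale R g c m k = if m = k then c ^ (m : ℕ) else 0 := by
  rw [thetaScale, Matrix.diagonal_apply]

/-- `D_c D_d = D_{cd}`. [cite: Mukai1981, Prop. 3.11 (1) and (3.12) (p. 162)] -/
theorem thetaScale_mul_thetaScale (c d : R) : thetaScale R g c * thetaScale R g d = thetaScale R g (c * d) := by
  rw [thetaScale, thetaScale, thetaScale, Matrix.diagonal_mul_diagonal]
  congr 1
  ext k
  rw [mul_pow]

/-- `D_1 = 1`. [cite: Mukai1981, Prop. 3.11 (1) and (3.12) (p. 162)] -/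
theorem thetaScale_one : thetaScale R g 1 = 1 := by
  rw [thetaScale]
  convert Matrix.diagonal_one using 2
  ext k
  rw [one_pow]

/-- `D_c` on a slope: `D_c e^{aθ} = e^{caθ}`. [cite: Mukai1981, Prop. 3.11 (1) and (3.12) (p. 162)] -/
theorem thetaScale_mulVec_thetaExp (c a : R) : thetaScale R g c *ᵥ thetaExp R g a = thetaExp R g (c * a) := by
  ext m
  rw [thetaScale, Matrix.mulVec_diagonal, thetaExp_apply, thetaExp_apply, mul_pow]

/-- **`D_c T_a = T_{ca} D_c`**: the substitution `θ ↦ cθ` conjugates the twist by `e^{aθ}` into the twist by `e^{caθ}`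
(`n_X^* ∘ (⊗L^{a}) = (⊗L^{n²a}) ∘ n_X^*` at class level). [cite: Mukai1981, Prop. 3.11 (1) and (3.12) (p. 162)] -/
theorem thetaScale_mul_twist (c a : R) : thetaScale R g c * twist R g a = twist R g (c * a) * thetaScale R g c := by
  ext m k
  rw [thetaScale, Matrix.diagonal_mul, Matrix.mul_diagonal, twist_apply, twist_apply]
  by_cases h : (k : ℕ) ≤ (m : ℕ)
  · rw [mul_pow, show c ^ (m : ℕ) = c ^ ((m : ℕ) - k) * c ^ (k : ℕ) by rw [← pow_add, Nat.sub_add_cancel h]]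
    ring
  · rw [Nat.choose_eq_zero_of_lt (by omega), Nat.cast_zero]
    simp

/-- **`D_c S D_c = c^g S`**. [cite: Mukai1981, Prop. 3.11 (1) and (3.12) (p. 162)] [cite: Beauville1983FourierChow, Prop. 5 (p. 248)] -/
theorem thetaScale_mul_fourier_mul_thetaScale (c : R) :
    thetaScale R g c * fourier R g * thetaScale R g c = c ^ g • fourier R g := by
  ext m p
  rw [thetaScale, Matrix.mul_diagonal, Matrix.diagonal_mul, fourier_apply, Matrix.smul_apply, fourier_apply,
    smul_eq_mul]
  split_ifs with h
  · subst h
    have hv : (m : ℕ) + ((Fin.rev m : Fin (g + 1)) : ℕ) = g := by rw [Fin.val_rev]; omega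
    rw [show c ^ g = c ^ (m : ℕ) * c ^ ((Fin.rev m : Fin (g + 1)) : ℕ) by rw [← pow_add, hv]]
    ring
  · rw [mul_zero, zero_mul, mul_zero]

/-- **[Mukai1981] Prop. 3.11 (1) at class level, for `N = 𝒪(nΘ)` on a principally polarized abelian variety**: the printed
`φ_N^* N̂ ≅ (N^{-1})^{⊕|χ(N)|}` reads, with `φ_N = φ_Θ ∘ n_X`, `ch(N) = e^{nθ}`, `χ(N) = n^g` and `n_X^* = D_{n²}` on the
theta powers: `D_{n²} (S e^{nθ}) = n^g e^{-nθ}` — every `g`, every commutative ring, every `n`.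
[cite: Mukai1981, Prop. 3.11 (1) (p. 162)] [cite: Beauville1983FourierChow, Prop. 5 (p. 248)] -/
theorem thetaScale_sq_mulVec_fourier_mulVec_thetaExp (n : R) :
    thetaScale R g (n ^ 2) *ᵥ (fourier R g *ᵥ thetaExp R g n) = n ^ g • thetaExp R g (-n) := by
  ext m
  rw [thetaScale, Matrix.mulVec_diagonal, fourier_mulVec, thetaExp_apply, Pi.smul_apply, thetaExp_apply, smul_eq_mul]
  have hv : ((Fin.rev m : Fin (g + 1)) : ℕ) = g - (m : ℕ) := by rw [Fin.val_rev]; omega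
  rw [hv, neg_pow n, show (n ^ 2) ^ (m : ℕ) * ((-1 : R) ^ (m : ℕ) * n ^ (g - (m : ℕ))) =
    (-1 : R) ^ (m : ℕ) * (n ^ (m : ℕ) * (n ^ (m : ℕ) * n ^ (g - (m : ℕ)))) by ring, ← pow_add,
    Nat.add_sub_cancel' (show (m : ℕ) ≤ g from Nat.le_of_lt_succ m.isLt)]
  ring

/-- The conjugation step behind the cube law: with `M_n := T_n D_{n²} S` one has `M_n D_n = n^g D_n (T S)`.
[cite: Mukai1981, (3.12) (p. 162)] -/
theorem twist_mul_thetaScale_mul_fourier_mul_thetaScale (n : R) :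
    twist R g n * thetaScale R g (n ^ 2) * fourier R g * thetaScale R g n =
      n ^ g • (thetaScale R g n * (twist R g 1 * fourier R g)) := by
  rw [pow_two, ← thetaScale_mul_thetaScale]
  calc twist R g n * (thetaScale R g n * thetaScale R g n) * fourier R g * thetaScale R g n
      = twist R g n * thetaScale R g n * (thetaScale R g n * fourier R g * thetaScale R g n) := by
        simp only [Matrix.mul_assoc]
    _ = n ^ g • (twist R g (n * 1) * thetaScale R g n * fourier R g) := by
        rw [thetaScale_mul_fourier_mul_thetaScale, Matrix.mul_smul, mul_one]
    _ = n ^ g • (thetaScale R g n * (twist R g 1 * fourier R g)) := by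
        rw [← thetaScale_mul_twist, Matrix.mul_assoc]

/-- The cube law up to the right factor `D_n`, over every commutative ring: `M_n³ D_n = (-1)^g n^{3g} D_n`.
[cite: Mukai1981, (3.12) (p. 162)] -/
theorem twist_mul_thetaScale_mul_fourier_pow_three_mul_thetaScale (n : R) :
    (twist R g n * thetaScale R g (n ^ 2) * fourier R g) ^ 3 * thetaScale R g n =
      ((-1 : R) ^ g * n ^ (3 * g)) • thetaScale R g n := by
  have h1 := twist_mul_thetaScale_mul_fourier_mul_thetaScale (R := R) g n
  have hW3 := twist_mul_fourier_pow_three (R := R) g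
  generalize twist R g n * thetaScale R g (n ^ 2) * fourier R g = M at h1 ⊢
  generalize thetaScale R g n = D at h1 ⊢
  generalize twist R g 1 * fourier R g = W at h1 hW3
  have h2 : ∀ X : Matrix (Fin (g + 1)) (Fin (g + 1)) R, M * (D * X) = n ^ g • (D * (W * X)) := by
    intro X
    rw [← Matrix.mul_assoc, h1, Matrix.smul_mul, Matrix.mul_assoc]
  have hW3' : W * (W * W) = (-1 : R) ^ g • 1 := by rw [← pow_three, hW3]
  rw [pow_three, Matrix.mul_assoc, Matrix.mul_assoc, ← Matrix.mul_one D]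
  simp only [h2, Matrix.mul_smul, smul_smul]
  simp only [Matrix.mul_one]
  rw [hW3', Matrix.mul_smul, Matrix.mul_one, smul_smul]
  congr 1
  ring

end ThetaScale

section NonprincipalCube

open Polynomial

variable (g : ℕ)

/-- Right-cancellation of `D_X = diag(X^k)` over the domain `ℤ[X]`. [folklore] -/
private theorem mul_thetaScale_X_injective :
    Function.Injective fun A : Matrix (Fin (g + 1)) (Fin (g + 1)) ℤ[X] => A * thetaScale ℤ[X] g X := by
  intro A B h
  refine Matrix.ext fun i j => ?_
  have hij := congr_fun (congr_fun h i) j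
  simp only [thetaScale, Matrix.mul_diagonal] at hij
  exact mul_right_cancel₀ (pow_ne_zero (j : ℕ) (Polynomial.X_ne_zero : (X : ℤ[X]) ≠ 0)) hij

/-- The cube law over `ℤ[X]` with `n = X`. [cite: Mukai1981, (3.12) (p. 162)] -/
private theorem cube_law_X :
    (twist ℤ[X] g X * thetaScale ℤ[X] g (X ^ 2) * fourier ℤ[X] g) ^ 3 =
      ((-1 : ℤ[X]) ^ g * X ^ (3 * g)) • (1 : Matrix (Fin (g + 1)) (Fin (g + 1)) ℤ[X]) := by
  apply mul_thetaScale_X_injective g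
  show _ * thetaScale ℤ[X] g X = _ * thetaScale ℤ[X] g X
  rw [twist_mul_thetaScale_mul_fourier_pow_three_mul_thetaScale, Matrix.smul_mul, Matrix.one_mul]

variable {S : Type*} [CommRing S] (φ : ℤ[X] →+* S)

/-- `T`, `D`, `S` are defined over `ℤ[X]` and specialise under ring maps. [folklore] -/
private theorem mapMatrix_twist_thetaScale_fourier :
    φ.mapMatrix (twist ℤ[X] g X) = twist S g (φ X) ∧
    φ.mapMatrix (thetaScale ℤ[X] g (X ^ 2)) = thetaScale S g (φ X ^ 2) ∧
    φ.mapMatrix (fourier ℤ[X] g) = fourier S g := by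
  refine ⟨?_, ?_, ?_⟩
  · ext m k; simp only [RingHom.mapMatrix_apply, Matrix.map_apply, twist_apply, map_mul, map_natCast, map_pow]
  · ext m k
    simp only [RingHom.mapMatrix_apply, Matrix.map_apply, thetaScale_apply, apply_ite φ, map_pow, map_zero]
  · ext m p
    simp only [RingHom.mapMatrix_apply, Matrix.map_apply, fourier_apply, apply_ite φ, map_pow, map_neg, map_one, map_zero]

/-- **The non-principal cube law, every `g`, every commutative ring, every `n`** — the class-level shadow of [Mukai1981]
(3.12) «`(⊗N ∘ φ_N^* ∘ R𝒮̂)³ [g + i(N)] ≅ (⊗𝒪_X̂^{⊕|χ(N)|}) ∘ φ_N^* ∘ φ_{N*}`» for the polarization `N = 𝒪(nΘ)` of a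
principally polarized abelian `g`-fold: with `⊗N = T_n`, `φ_N^* = n_X^* φ_Θ^* = D_{n²}` composed with the Fourier matrix `S`,
`|χ(N)| = n^g`, `φ_N^* φ_{N*} = deg φ_N = n^{2g}` on classes and the shift `[g + i(N)] = [g]` (`N` ample) acting by
`(-1)^g` on even classes: **`(T_n D_{n²} S)³ = (-1)^g n^{3g} · 1`**. At `n = 1` this is the leaf's `twist_mul_fourier_pow_three`.
Proof: `D_n S D_n = n^g S` and `D_n T_1 = T_n D_n` give `M_n D_n = n^g D_n (T_1 S)`, hence `M_n³ D_n = n^{3g} D_n (T_1 S)³ =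
(-1)^g n^{3g} D_n` over every ring; the factor `D_n` is cancelled over the domain `ℤ[X]` (`n = X`) and the identity is then
specialised along `ℤ[X] → R`, `X ↦ n`. Matrix algebra of the theta-power model; the printed (3.12) is CITED as the dictionary,
not proved; no abelian variety is constructed. [cite: Mukai1981, (3.12) (p. 162)] [cite: Beauville1983FourierChow, Prop. 5 (p. 248)] -/
theorem twist_mul_thetaScale_mul_fourier_pow_three (n : R) :
    (twist R g n * thetaScale R g (n ^ 2) * fourier R g) ^ 3 =
      ((-1 : R) ^ g * n ^ (3 * g)) • (1 : Matrix (Fin (g + 1)) (Fin (g + 1)) R) := by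
  let φ : ℤ[X] →+* R := Polynomial.eval₂RingHom (Int.castRingHom R) n
  have hφX : φ X = n := Polynomial.eval₂_X _ _
  obtain ⟨h1, h2, h3⟩ := mapMatrix_twist_thetaScale_fourier g φ
  have h := congrArg φ.mapMatrix (cube_law_X g)
  rw [map_pow, map_mul, map_mul, h1, h2, h3, hφX] at h
  rw [h]
  ext i j
  simp only [RingHom.mapMatrix_apply, Matrix.map_apply, Matrix.smul_apply, Matrix.one_apply, smul_eq_mul, mul_ite,
    mul_one, mul_zero, apply_ite φ, map_mul, map_pow, map_neg, map_one, map_zero, hφX]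

end NonprincipalCube

section ThetaCoscale

/-! ### The pushforward scale and [Mukai1981] Prop. 3.11 (2) at class level (g20, staged v11)

`thetaCoscale R g c = diag(c^{g-k})`: for `c = n²` this is the class of `n_{X*}` on `⊕ H^{2k}` in the basis `θ^k/k!`
(`n_{X*} n_X^* = deg n_X = n^{2g}`, `n_X^* = n^{2k}` on `H^{2k}`), so `thetaCoscale (n^2) * thetaScale (n^2) = n^{2g} • 1`.
Prop. 3.11 (2) «N̂^{⊕|χ(N)|} ≅ φ_{N*}N^{−1}» for `N = 𝒪(nΘ)` on a principally polarized `(X, Θ)` (`χ(N) = n^g`,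
`φ_N = φ_Θ ∘ n_X`, `ch(π_* F) = π_* ch(F)` for an isogeny π) reads `n^g · S(e^{nθ}) = E_{n²} e^{−nθ}` with `E = thetaCoscale`. -/

variable (g : ℕ)

variable (R) in
/-- `E_c := diag(c^{g-k})`, the pushforward scale (`c = n²` ↦ the class of `n_{X*}`).
[cite: Mukai1981, Prop. 3.11 (2) (p. 162)] -/
def thetaCoscale (c : R) : Matrix (Fin (g + 1)) (Fin (g + 1)) R := Matrix.diagonal fun k => c ^ (g - (k : ℕ))

/-- Entries of `E_c`. [cite: Mukai1981, Prop. 3.11 (2) (p. 162)] -/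
@[simp] theorem thetaCoscale_apply (c : R) (m k : Fin (g + 1)) :
    thetaCoscale R g c m k = if m = k then c ^ (g - (k : ℕ)) else 0 := by
  rw [thetaCoscale, Matrix.diagonal_apply]
  split_ifs with h
  · rw [h]
  · rfl

/-- `E_1 = 1`. [cite: Mukai1981, Prop. 3.11 (2) (p. 162)] -/
theorem thetaCoscale_one : thetaCoscale R g 1 = 1 := by
  rw [thetaCoscale, ← Matrix.diagonal_one]
  congr 1
  ext k
  rw [one_pow]

/-- `E_c D_c = c^g · 1` (`n_{X*} n_X^* = deg n_X`). [cite: Mukai1981, Prop. 3.11 (2) (p. 162)] -/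
theorem thetaCoscale_mul_thetaScale (c : R) : thetaCoscale R g c * thetaScale R g c = c ^ g • (1 : Matrix _ _ R) := by
  rw [thetaCoscale, thetaScale, Matrix.diagonal_mul_diagonal, ← Matrix.diagonal_one, ← Matrix.diagonal_smul]
  congr 1
  ext k
  rw [Pi.smul_apply, smul_eq_mul, mul_one, ← pow_add, Nat.sub_add_cancel (Nat.le_of_lt_succ k.isLt)]

/-- `D_c E_c = c^g · 1`. [cite: Mukai1981, Prop. 3.11 (2) (p. 162)] -/
theorem thetaScale_mul_thetaCoscale (c : R) : thetaScale R g c * thetaCoscale R g c = c ^ g • (1 : Matrix _ _ R) := by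
  rw [thetaCoscale, thetaScale, Matrix.diagonal_mul_diagonal, ← Matrix.diagonal_one, ← Matrix.diagonal_smul]
  congr 1
  ext k
  rw [Pi.smul_apply, smul_eq_mul, mul_one, ← pow_add, Nat.add_sub_cancel' (Nat.le_of_lt_succ k.isLt)]

/-- `E_c (D_c v) = c^g • v` (`n_{X*} n_X^* = deg n_X` on classes). [cite: Mukai1981, Prop. 3.11 (2) (p. 162)] -/
theorem thetaCoscale_mulVec_thetaScale_mulVec (c : R) (v : Fin (g + 1) → R) :
    thetaCoscale R g c *ᵥ (thetaScale R g c *ᵥ v) = c ^ g • v := by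
  rw [Matrix.mulVec_mulVec, thetaCoscale_mul_thetaScale, Matrix.smul_mulVec, Matrix.one_mulVec]

/-- **[Mukai1981] Prop. 3.11 (2) at class level for `N = 𝒪(nΘ)`**: `N̂^{⊕|χ(N)|} ≅ φ_{N*} N^{-1}` reads
`n^g · S(e^{nθ}) = E_{n²} e^{-nθ}` (`φ_{N*} = φ_{Θ*} n_{X*}`, and `φ_Θ` identifies `X̂` with `X`).
[cite: Mukai1981, Prop. 3.11 (2) (p. 162)] [cite: Beauville1983FourierChow, Prop. 5 (p. 248)] -/
theorem smul_fourier_mulVec_thetaExp_eq_thetaCoscale_mulVec (n : R) :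
    n ^ g • (fourier R g *ᵥ thetaExp R g n) = thetaCoscale R g (n ^ 2) *ᵥ thetaExp R g (-n) := by
  ext m
  rw [Pi.smul_apply, smul_eq_mul, fourier_mulVec, thetaExp_apply, thetaCoscale, Matrix.mulVec_diagonal, thetaExp_apply]
  have hv : ((Fin.rev m : Fin (g + 1)) : ℕ) = g - (m : ℕ) := by rw [Fin.val_rev]; omega
  rw [hv, neg_pow n, ← pow_mul]
  have e : n ^ g * n ^ (g - (m : ℕ)) = n ^ (2 * (g - (m : ℕ))) * n ^ (m : ℕ) := by
    rw [← pow_add, ← pow_add]; congr 1; have := Nat.le_of_lt_succ m.isLt; omega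
  calc n ^ g * ((-1 : R) ^ (m : ℕ) * n ^ (g - (m : ℕ))) = (-1 : R) ^ (m : ℕ) * (n ^ g * n ^ (g - (m : ℕ))) := by ring
    _ = (-1 : R) ^ (m : ℕ) * (n ^ (2 * (g - (m : ℕ))) * n ^ (m : ℕ)) := by rw [e]
    _ = n ^ (2 * (g - (m : ℕ))) * ((-1 : R) ^ (m : ℕ) * n ^ (m : ℕ)) := by ring

/-- Prop. 3.11 (1) and (2) together at class level: applying `E_{n²}` to (1) returns `n^{2g} · S(e^{nθ})`
(`n_{X*} n_X^* = n^{2g}`), consistent with (2) times `n^g = |χ(N)|`. [cite: Mukai1981, Prop. 3.11 (1)(2) (p. 162)] -/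
theorem thetaCoscale_sq_mulVec_smul_thetaExp_neg (n : R) :
    thetaCoscale R g (n ^ 2) *ᵥ (n ^ g • thetaExp R g (-n)) = (n ^ 2) ^ g • (fourier R g *ᵥ thetaExp R g n) := by
  rw [← thetaScale_sq_mulVec_fourier_mulVec_thetaExp, thetaCoscale_mulVec_thetaScale_mulVec]

end ThetaCoscale

/-! ### The `e₀`-image of the norm lattice, every `g` (g20, staged): `λ₀(N_g ℤ^{g+1}) = R(g) ℤ`, `R(g) = p` for
`g = p^a` a prime power and `R(g) = 1` otherwise (`g ≥ 2`) — the `N_g(ℤ^{g+1})` half of the `e₀`-gcd law (U-TATE note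
§2ter) as a kernel theorem, via B. Ram's theorem (1909) on `gcd_{0<k<n} C(n,k)` — which Mathlib HAS
(`Choose.gcd_choose_eq_minFac_of_isPrimePow` ∕ `Choose.gcd_choose_eq_one_of_not_isPrimePow`, file
`Mathlib.Data.Nat.Choose.Lucas`; used here through two divisor-form corollaries, nothing re-proved) — and Bézout for
`Finset.gcd` over `ℤ` (Mathlib `Finset.gcd_eq_sum_mul`). -/

section Ram

/-- **Ram (1909), prime-power case, divisor form** — a corollary of Mathlib's `Choose.gcd_choose_eq_minFac_of_isPrimePow`
(«for a prime power `n`, the gcd of `C(n,1), …, C(n,n-1)` is `n.minFac`»): a common divisor of the inner binomial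
coefficients of row `n = p^a` divides `p = n.minFac`. The theorem is B. Ram's (1909), restated as McTague's THEOREM 1 «For
any integer n > 1 and any prime p: gcd_{0<k<n} C(n,k) = p if n = p^i for some i > 0, 1 otherwise».
[cite: Ram1909, Thm. (pp. 39–43)] [cite: Mctague2015, Thm. 1 (p. 353)] -/
theorem dvd_minFac_of_forall_dvd_choose {n d : ℕ} (h : IsPrimePow n)
    (hd : ∀ k : ℕ, 0 < k → k < n → d ∣ n.choose k) : d ∣ n.minFac := by
  rw [← Choose.gcd_choose_eq_minFac_of_isPrimePow h]
  refine Finset.dvd_gcd fun k hk => ?_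
  rw [Finset.mem_Icc] at hk
  have h2 := h.two_le
  exact hd k hk.1 (by omega)

/-- **Ram (1909), composite case, divisor form** — a corollary of Mathlib's `Choose.gcd_choose_eq_one_of_not_isPrimePow`
(«for `n > 1` not a prime power, the gcd of `C(n,1), …, C(n,n-1)` is `1`»): a common divisor of the inner binomial
coefficients of a row `n ≥ 2` that is not a prime power is `1`. [cite: Ram1909, Thm. (pp. 39–43)]
[cite: Mctague2015, Thm. 1 (p. 353)] -/
theorem eq_one_of_forall_dvd_choose {n d : ℕ} (hn : 2 ≤ n) (h : ¬ IsPrimePow n)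
    (hd : ∀ k : ℕ, 0 < k → k < n → d ∣ n.choose k) : d = 1 := by
  have hG : d ∣ (Finset.Icc 1 (n - 1)).gcd n.choose := by
    refine Finset.dvd_gcd fun k hk => ?_
    rw [Finset.mem_Icc] at hk
    exact hd k hk.1 (by omega)
  rw [Choose.gcd_choose_eq_one_of_not_isPrimePow (by omega) h] at hG
  exact Nat.dvd_one.mp hG

end Ram

section EndCoordinateImage

variable (g : ℕ)

/-- The `e₀`-coordinate of the norm as a linear form: `(N_g u)_0 = Σ_k ([k=0] + ε C(g,k) + [k=g]) u_k`.
[cite: Mukai1981, Thm. 3.13 (6) and (3.14) (p. 163)] -/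
theorem normSum_apply_zero_eq_sum (u : Fin (g + 1) → R) :
    normSum R g u 0 = ∑ k : Fin (g + 1),
      ((if k = 0 then 1 else 0) + (-1 : R) ^ g * ((g.choose k : ℕ) : R) + (if k = Fin.last g then 1 else 0)) * u k := by
  rw [normSum_apply_zero]
  simp only [add_mul, Finset.sum_add_distrib, ite_mul, one_mul, zero_mul, Finset.sum_ite_eq', Finset.mem_univ,
    if_true, mul_assoc, ← Finset.mul_sum]

/-- **The `e₀`-image of the norm lattice is principal, generated by the gcd of the coefficients**
(Bézout over `ℤ`, Mathlib `Finset.gcd_eq_sum_mul`). [cite: Mukai1981, Thm. 3.13 (6) and (3.14) (p. 163)] -/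
theorem exists_normSum_apply_zero_eq_iff_gcd_dvd (d : ℤ) :
    (∃ u : Fin (g + 1) → ℤ, normSum ℤ g u 0 = d) ↔
      (Finset.univ.gcd fun k : Fin (g + 1) =>
        (if k = 0 then 1 else 0) + (-1 : ℤ) ^ g * ((g.choose k : ℕ) : ℤ) + (if k = Fin.last g then 1 else 0)) ∣ d := by
  set c : Fin (g + 1) → ℤ := fun k =>
    (if k = 0 then 1 else 0) + (-1 : ℤ) ^ g * ((g.choose k : ℕ) : ℤ) + (if k = Fin.last g then 1 else 0) with hc
  constructor
  · rintro ⟨u, rfl⟩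
    rw [normSum_apply_zero_eq_sum]
    exact Finset.dvd_sum fun k _ => Dvd.dvd.mul_right (Finset.gcd_dvd (Finset.mem_univ k)) _
  · rintro ⟨t, rfl⟩
    obtain ⟨w, hw⟩ := Finset.gcd_eq_sum_mul (Finset.univ : Finset (Fin (g + 1))) c
    refine ⟨fun k => w k * t, ?_⟩
    rw [normSum_apply_zero_eq_sum, hw, Finset.sum_mul]
    refine Finset.sum_congr rfl fun k _ => ?_
    ring

/-- **The `e₀`-coordinate law of the norm lattice, every `g ≥ 2`** (U-TATE note §2ter, the `N_g(ℤ^{g+1})` half, now in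
the kernel): `{(N_g u)_0 : u ∈ ℤ^{g+1}} = R(g) ℤ` with `R(g) = p` when `g = p^a` is a prime power and `R(g) = 1`
otherwise — Ram's theorem on `gcd_{0<k<g} C(g,k)` together with `gcd(1 + ε, R(g)) = R(g)` (`ε = (-1)^g`; an even prime
power is a power of `2`). [cite: Mukai1981, Thm. 3.13 (6) and (3.14) (p. 163)] -/
theorem exists_normSum_apply_zero_eq_iff (hg : 2 ≤ g) (d : ℤ) :
    (∃ u : Fin (g + 1) → ℤ, normSum ℤ g u 0 = d) ↔ ((if IsPrimePow g then g.minFac else 1 : ℕ) : ℤ) ∣ d := by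
  rw [exists_normSum_apply_zero_eq_iff_gcd_dvd]
  set G := (Finset.univ.gcd fun k : Fin (g + 1) =>
    (if k = 0 then 1 else 0) + (-1 : ℤ) ^ g * ((g.choose k : ℕ) : ℤ) + (if k = Fin.last g then 1 else 0)) with hG
  set Rg : ℕ := if IsPrimePow g then g.minFac else 1 with hRg
  have h0l : (0 : Fin (g + 1)) ≠ Fin.last g := by
    intro e; have := congrArg Fin.val e; rw [Fin.val_zero, Fin.val_last] at this; omega
  -- (i) R(g) divides every coefficient
  have hR1 : (Rg : ℤ) ∣ 1 + (-1 : ℤ) ^ g := by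
    rw [hRg]; split_ifs with h
    · obtain ⟨p, a, hp, ha, hpa⟩ := h
      rw [← Nat.prime_iff] at hp
      subst hpa
      rw [Nat.Prime.pow_minFac hp (by omega)]
      by_cases h2 : p = 2
      · subst h2
        have he : Even (2 ^ a) := (Nat.even_pow' (by omega)).mpr (by decide)
        rw [he.neg_one_pow]; norm_num
      · have ho : Odd (p ^ a) := Odd.pow (hp.odd_of_ne_two h2)
        rw [ho.neg_one_pow]; norm_num
    · simp
  have hRC : ∀ k : ℕ, 0 < k → k < g → (Rg : ℤ) ∣ ((g.choose k : ℕ) : ℤ) := by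
    intro k hk0 hkg
    rw [hRg]; split_ifs with h
    · obtain ⟨p, a, hp, ha, hpa⟩ := h
      rw [← Nat.prime_iff] at hp
      subst hpa
      rw [Nat.Prime.pow_minFac hp (by omega)]
      exact Int.natCast_dvd_natCast.mpr (hp.dvd_choose_pow (by omega) (by omega))
    · simp
  have hRG : (Rg : ℤ) ∣ G := by
    refine Finset.dvd_gcd fun k _ => ?_
    by_cases hk0 : k = 0
    · subst hk0
      rw [if_pos rfl, if_neg h0l, Fin.val_zero, Nat.choose_zero_right, Nat.cast_one, mul_one, add_zero]
      exact hR1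
    by_cases hkl : k = Fin.last g
    · subst hkl
      rw [if_neg h0l.symm, if_pos rfl, Fin.val_last, Nat.choose_self, Nat.cast_one, mul_one, zero_add, add_comm]
      exact hR1
    · rw [if_neg hk0, if_neg hkl, zero_add, add_zero]
      refine Dvd.dvd.mul_left (hRC k ?_ ?_) _
      · exact Nat.pos_of_ne_zero fun e => hk0 (Fin.ext (by rw [Fin.val_zero]; exact e))
      · exact lt_of_le_of_ne (Nat.le_of_lt_succ k.isLt) fun e => hkl (Fin.ext (by rw [Fin.val_last]; exact e))
  -- (ii) G divides every inner binomial coefficient, hence R(g) (Ram)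
  have hGC : ∀ k : ℕ, 0 < k → k < g → G.natAbs ∣ g.choose k := by
    intro k hk0 hkg
    have hmem := Finset.gcd_dvd (f := fun k : Fin (g + 1) =>
      (if k = 0 then 1 else 0) + (-1 : ℤ) ^ g * ((g.choose k : ℕ) : ℤ) + (if k = Fin.last g then 1 else 0))
      (Finset.mem_univ (⟨k, by omega⟩ : Fin (g + 1)))
    have hk0' : (⟨k, by omega⟩ : Fin (g + 1)) ≠ 0 := fun e => by
      have := congrArg Fin.val e; rw [Fin.val_mk, Fin.val_zero] at this; omega
    have hkl' : (⟨k, by omega⟩ : Fin (g + 1)) ≠ Fin.last g := fun e => by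
      have := congrArg Fin.val e; rw [Fin.val_mk, Fin.val_last] at this; omega
    rw [if_neg hk0', if_neg hkl', zero_add, add_zero, ← hG] at hmem
    have := Int.natAbs_dvd_natAbs.mpr hmem
    rwa [Int.natAbs_mul, Int.natAbs_pow, Int.natAbs_neg, Int.natAbs_one, one_pow, one_mul,
      Int.natAbs_natCast] at this
  have hGR : G.natAbs ∣ Rg := by
    rw [hRg]; split_ifs with h
    · exact dvd_minFac_of_forall_dvd_choose h hGC
    · rw [eq_one_of_forall_dvd_choose hg h hGC]
  have hGeq : G.natAbs = Rg := Nat.dvd_antisymm hGR (by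
    have := Int.natAbs_dvd_natAbs.mpr hRG; rwa [Int.natAbs_natCast] at this)
  rw [← Int.natAbs_dvd, hGeq]

end EndCoordinateImage

end ThetaPowers

end Literature.AlgebraicGeometry.AbelianVarieties
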